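/-
Copyright (c) 2026. All rights reserved.
Released under Apache 2.0 license as described in the file LICENSE.
-/
import Literature.Geometry.Kaehler.ComplexTorusQuaternionXSixSpecialCyclesDegree
import HarnessLib

/-!
# The structure of the degree sum `deg Z(t)_ℚ = 2·Σ_{x ∈ L(t) mod Γ} e_x⁻¹` for GENERAL `t`:
# three index sets, scaling by the ramified primes, and the reduction to primitive class numbers

[tag: complex_torus] [tag: abelian_surface] [tag: quaternion_multiplication] [tag: complex_multiplication]
[tag: shimura_curve] [tag: special_cycles] [tag: cm_points] [tag: optimal_embedding] [tag: quaternion_order]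

Kudla–Rapoport–Yang compute the degree of the special `0`-cycle `Z(t)` on the Shimura curve of discriminant `D(B)` as
«a counting problem» [KRY, (3.4.13)–(3.4.14)]: `Z(t)(ℂ) = Σ_{x ∈ L(t) mod Γ} pr(D_x)`, `deg Z(t)_ℚ = 2·Σ_{x ∈ L(t) mod Γ}
e_x⁻¹`, where `Γ = O_B^×` is the FULL unit group of the maximal order [KRY, §3.2 p. 48], `L(t)` the special vectors of
norm `t`, and `e_x = |Γ_x|` the order of the stabiliser of `x` — and they state the answer as the class-number expression
(3.4.4)–(3.4.6) `deg Z(t)_ℚ = 2·δ(d, D)·H₀(t, D)`, `H₀(t, D) = Σ_{c ∣ n, (c, D) = 1} h(c²d)/w(c²d)`, `4t = n²d`.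

The sibling file `…XSixSpecialCyclesDegree` made both sides honest functions of the tree's objects for `D(B) = 6`
(`B = (−1,3)_ℚ`, `O₆ = ℤ⟨1, i, j, ij⟩ + ℤe`, `e = (1 + i + j − ij)/2`, `L(t) = {x ∈ ℤ³ : x₁² − 3x₂² − 3x₃² = t}`,
`x̂ = x₁i + x₂j + x₃ij`, `Γ_x = {u ∈ O₆^× : ux̂ = x̂u}`, `e_x = Nat.card Γ_x`, `deg Z(t)_ℚ := 2·Σᶠ_{q ∈ L(t)/O₆^×}
(e_{q.out})⁻¹`) and verified the equality of (3.4.14) with (3.4.4)·(3.4.6) for twelve values of `t`, one at a time.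
This file proves what holds for EVERY `t`, i.e. the structure of the left side of (3.4.14):

* §1 `e` IS INSENSITIVE TO SIGN, PARTNER AND CONTENT: `e_{−x} = e_x`, `e_{x^e} = e_x` for the partner
  `x^e = Ad(e)x = (−2x₁ + 3x₂, −x₃, x₁ − 2x₂)` (conjugation by the norm-`−1` unit `ē`), `e_{c·x} = e_x` (`c ∈ ℚ^×`), and
  `e` is constant on `Γ₆ = O₆¹`-classes and on sign classes (`e` at `Quot.out` of a class is `e` of any member).
* §2 THREE INDEX SETS, ONE DEGREE (`t > 0`):
  **`Σᶠ_{[x] ∈ L(t)/Γ₆} e_x⁻¹ = 2·Σᶠ_{[x] ∈ L(t)/O₆^×} e_x⁻¹ = 4·Σᶠ_{{±x} ∈ L(t)/±O₆^×} e_x⁻¹`** — the degree of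
  (3.4.14) is the plain orbifold count over the classes modulo the Fuchsian group `Γ₆ = O₆¹` uniformising
  `X₆ = Γ₆∖ℌ` (the factor `2` of (3.4.14) is the index `[O₆^× : Γ₆·{±1}]`-effect `|L(t)/Γ₆| = 2|L(t)/O₆^×|` of
  `…XSixSpecialCyclesClassCount`, now WEIGHTED by `e⁻¹`: the fibres `{[x̂], [x̂^e]}` of `L(t)/Γ₆ → L(t)/O₆^×` carry equal
  weights), and twice the count over the sign pairs `{x, −x}` («by (i), the vectors `x` and `−x` both contribute the same
  pair of points to the sum» [KRY, p. 54]); e.g. `Σᶠ_{L(1)/Γ₆} e⁻¹ = 4·¼ = 1`, `Σᶠ_{L(3)/Γ₆} e⁻¹ = 4·⅙ = 2/3` (the elliptic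
  points of orders `2` and `3` of `X₆`).
* §3 THE RAMIFIED PRIMES `2, 3 ∣ D(B)` DO NOT CHANGE THE DEGREE: **`Σᶠ_{L(4t)/O₆^×} e⁻¹ = Σᶠ_{L(t)/O₆^×} e⁻¹`,
  `Σᶠ_{L(9t)/O₆^×} e⁻¹ = Σᶠ_{L(t)/O₆^×} e⁻¹`, hence `deg Z(4^a9^bt)_ℚ = deg Z(t)_ℚ`** for every `t` — the descent
  `L(4t) = 2·L(t)`, `L(9t) = 3·L(t)` of `…XSixSpecialCyclesScaling` (`[ŷ] ↦ [2ŷ]` is a bijection of `O₆^×`-classes and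
  `e_{2y} = e_y`). On the right side of (3.4.4)·(3.4.6) this is the restriction `(c, D) = 1`: `4·(4t) = (2n)²d` with the
  same `d`, so `δ(d, D)` is unchanged and `Σ_{c ∣ 2n, (c,6)=1} = Σ_{c ∣ n, (c,6)=1}` (`sum_divisors_two_mul_filter_coprime_six`,
  `sum_divisors_three_mul_filter_coprime_six`: a divisor of `2n` prime to `6` divides `n`).
* §4 THE REDUCTION TO PRIMITIVE CLASS NUMBERS (`t > 0`):
  **`Σᶠ_{[x] ∈ L(t)/O₆^×} e_x⁻¹ = Σ_{c = 1}^{t} |L_c(t)/O₆^×| / w_c(t)`**, `L_c(t)` = the primitive `p ∈ ℤ³` with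
  `c²Q(p) = t` (the stratum of content `c`; empty unless `c² ∣ t`), `w_c(t) = 4` if `c² = t` (`Q(p̂) = 1`, `Γ_x = ℤ[i]^×`),
  `6` if `3c² = t` (`Q(p̂) = 3`, `Γ_x = ℤ[ζ₃]^×`), `2` otherwise — KRY's `Σ_{c} h(c²d)/w(c²d)` SHAPE of `H₀` on the
  vector side: the content stratification `(c, [p̂]) ↦ [c·p̂]` of `…XSixSpecialCyclesContentCounts` is a bijection
  `⊔_c L_c(t)/O₆^× → L(t)/O₆^×` along which `e` is the constant `w_c(t)` (`card_unitStab_eq_two/four/six`); for squarefree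
  `t` a single stratum: `Σᶠ_{L(t)/O₆^×} e⁻¹ = |L(t)/O₆^×| / w(t)`, `w(1) = 4`, `w(3) = 6`, `w(t) = 2` otherwise.

What is NOT proved here: the identification, stratum by stratum, of `|L_c(t)/O₆^×|` with `δ(d, 6)·h(−disc)` (Eichler's
optimal-embedding theorem for all `t`, cf. `…XSixSpecialCyclesEichlerClassNumbers` for twelve values), hence not the
general equality (3.4.14) = (3.4.4)·(3.4.6).

## Sources

* [KRY] S. Kudla, M. Rapoport, T. Yang, *Modular Forms and Special Cycles on Shimura Curves*, Ann. of Math. Stud. 161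
  (2006), §3.2 p. 48 («`Γ = O_B^×`»), §3.4 (3.4.4)–(3.4.6) («`deg Z(t)_ℚ = 2δ(d;D(B))H₀(t;D(B))`», «`H₀(t;D) = Σ_{c∣n}
  h(c²d)/w(c²d)` … `(c, D) = 1`», «`w(c²d)` is the number of units in `O_{c²d}`»), Lemma 3.4.3 (i) («`−x ∉ Γ·x`»),
  (3.4.13)–(3.4.14) («`deg Z(t)_ℚ = 2 Σ_{x ∈ L(t) mod Γ} e_x⁻¹`»), p. 54 («the vectors `x` and `−x` both contribute the
  same pair of points to the sum»), Remark 3.4.7. [cite: KudlaRapoportYang2006, §3.2 p. 48; §3.4 (3.4.4)–(3.4.6), Lemma 3.4.3, (3.4.13)–(3.4.14), Remark 3.4.7]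
* [Vignéras] M.-F. Vignéras, *Arithmétique des algèbres de quaternions*, LNM 800 (1980), Ch. III §5.C Cor. 5.12–5.14
  p. 82–83 («`m_G = m_{𝒪^×}·[n(𝒪^×) : n(G)n(B^×)]`» for `𝒪¹ ⊂ G ⊂ N(𝒪)`; «`Σ_B m_G(B)` où `B` parcourt les ordres de
  `K(h)` contenant `h`»), Ch. IV §1 (the Fuchsian group `𝒪¹` and its elliptic points). [cite: VignerasLNM800, Ch. III §5.C Cor. 5.12–5.14; Ch. IV §1]
* [BT] P. Bayer, A. Travesa, *Uniformizing functions for certain Shimura curves, in the case `D = 6`*, Acta Arith. 126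
  (2007), §1 Thm. 1.1 (`X₆ = Γ₆∖ℌ`, `Γ₆ = O₆¹`; two elliptic points of order `2`, two of order `3`). [cite: BayerTravesa2007, §1 Thm. 1.1]

## Scope (honest)

Theorems only — no definitions, no named facts, no instances, no notation; all quotients, stabilisers and sums are the
inline expressions of `…XSixSpecialCyclesClassCount` / `…XSixSpecialCyclesDegree` / `…XSixSpecialCyclesContentCounts`.
The geometric readings (orbifold points of `X₆`, the stack `Z(t)`) are quoted from the sources, not formalised.
-/

set_option maxSynthPendingDepth 3

open Quaternion Literature.NumberTheory.QuadraticFields.Quadratic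

namespace Literature.Geometry.Kaehler.ComplexTorus.QuaternionType

/-! ## §0 Helpers -/

section Helpers

/-- **Two sheets, weighted**: if `π` is a fixed-point-free self-map of a finite type `Q`, `f : Q → Q'` is a surjection with
`f ∘ π = f` whose fibres are `{q, πq}`, then for any weight `g` on `Q'`, `Σᶠ_Q g ∘ f = 2·Σᶠ_{Q'} g` (`Q ≃ Q' ⊕ Q'`). [folklore] -/
private theorem finsum_comp_eq_two_mul_finsum₃₉ {Q Q' : Type*} [Finite Q] (π : Q → Q) (hπ : ∀ q, π q ≠ q)
    (f : Q → Q') (hf : Function.Surjective f) (hfπ : ∀ q, f (π q) = f q)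
    (hff : ∀ q₁ q₂, f q₁ = f q₂ → q₁ = q₂ ∨ q₁ = π q₂) (g : Q' → ℚ) :
    ∑ᶠ q, g (f q) = 2 * ∑ᶠ q', g q' := by
  classical
  haveI : Finite Q' := Finite.of_surjective f hf
  haveI := Fintype.ofFinite Q
  haveI := Fintype.ofFinite Q'
  have hfs : ∀ q', f (Function.surjInv hf q') = q' := Function.surjInv_eq hf
  have key : Function.Bijective (Sum.elim (Function.surjInv hf) (π ∘ Function.surjInv hf)) := by
    constructor
    · rintro (a | a) (a' | a') h <;> have h' := congrArg f h <;>
        simp only [Sum.elim_inl, Sum.elim_inr, Function.comp_apply, hfs, hfπ] at h h'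
      · rw [h']
      · subst h'; exact absurd h.symm (hπ _)
      · subst h'; exact absurd h (hπ _)
      · rw [h']
    · intro q
      rcases hff q (Function.surjInv hf (f q)) (by rw [hfs]) with h | h
      · exact ⟨Sum.inl (f q), h.symm⟩
      · exact ⟨Sum.inr (f q), h.symm⟩
  have h1 : ∑ᶠ s : Q' ⊕ Q', g (f (Sum.elim (Function.surjInv hf) (π ∘ Function.surjInv hf) s)) = ∑ᶠ q, g (f q) :=
    finsum_comp (g := fun q ↦ g (f q)) _ key
  rw [← h1, finsum_eq_sum_of_fintype, finsum_eq_sum_of_fintype, Fintype.sum_sum_type, two_mul]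
  simp only [Sum.elim_inl, Sum.elim_inr, Function.comp_apply, hfπ, hfs]

/-- A `finsum` over a finite type of a function with one value. [folklore] -/
private theorem finsum_eq_card_mul_of_forall_eq₃₉ {α : Type*} [Finite α] {f : α → ℚ} {a : ℚ} (h : ∀ x, f x = a) :
    ∑ᶠ x, f x = Nat.card α * a := by
  haveI := Fintype.ofFinite α
  rw [finsum_eq_sum_of_fintype, Finset.sum_congr rfl (fun x _ ↦ h x), Finset.sum_const, Finset.card_univ,
    Nat.card_eq_fintype_card, nsmul_eq_mul]

/-- `x̂̄ = −x̂` for a pure vector. [folklore] -/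
private theorem star_pureVec₃₉ (a b c : ℚ) : star (⟨0, a, b, c⟩ : ℍ[ℚ,((-1 : ℤ) : ℚ),((3 : ℤ) : ℚ)]) = -⟨0, a, b, c⟩ :=
  QuaternionAlgebra.star_eq_neg.mpr rfl

/-- The negative of an integral special vector, in coordinates. [folklore] -/
private theorem neg_pureVec₃₉ (x₁ x₂ x₃ : ℤ) :
    (⟨0, ((-x₁ : ℤ) : ℚ), ((-x₂ : ℤ) : ℚ), ((-x₃ : ℤ) : ℚ)⟩ : ℍ[ℚ,((-1 : ℤ) : ℚ),((3 : ℤ) : ℚ)]) = -⟨0, x₁, x₂, x₃⟩ := by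
  rw [QuaternionAlgebra.neg_mk]; ext <;> simp

/-- The pure vector of `c·y` (`c ∈ ℤ`) is `c •` the pure vector of `y`. [folklore] -/
private theorem pureVec_intMul₃₉ (c y₁ y₂ y₃ : ℤ) :
    (⟨0, ((c * y₁ : ℤ) : ℚ), ((c * y₂ : ℤ) : ℚ), ((c * y₃ : ℤ) : ℚ)⟩ : ℍ[ℚ,((-1 : ℤ) : ℚ),((3 : ℤ) : ℚ)]) = (c : ℚ) • ⟨0, (y₁ : ℚ), (y₂ : ℚ), (y₃ : ℚ)⟩ := by
  rw [QuaternionAlgebra.smul_mk]; push_cast; simp only [smul_eq_mul, mul_zero]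

/-- The pure vector of `c·x` (`c ∈ ℕ`, `x` a triple). [folklore] -/
private theorem natSmul_pureVec₃₉ (c : ℕ) (x : ℤ × ℤ × ℤ) :
    ((c : ℚ) • (⟨0, x.1, x.2.1, x.2.2⟩ : ℍ[ℚ,((-1 : ℤ) : ℚ),((3 : ℤ) : ℚ)])) =
      ⟨0, (((c : ℤ) * x.1 : ℤ) : ℚ), (((c : ℤ) * x.2.1 : ℤ) : ℚ), (((c : ℤ) * x.2.2 : ℤ) : ℚ)⟩ := by
  rw [QuaternionAlgebra.smul_mk]; push_cast; simp only [smul_eq_mul, mul_zero]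

/-- Primitivity of a triple in `Fin 3` form. [folklore] -/
private theorem prim_fin₃₉ {x : ℤ × ℤ × ℤ} (h : ∃ u : ℤ × ℤ × ℤ, u.1 * x.1 + u.2.1 * x.2.1 + u.2.2 * x.2.2 = 1) :
    ∃ w : Fin 3 → ℤ, ∑ k, w k * (![x.1, x.2.1, x.2.2] : Fin 3 → ℤ) k = 1 := by
  obtain ⟨u, hu⟩ := h
  exact ⟨![u.1, u.2.1, u.2.2], by simpa [Fin.sum_univ_three] using hu⟩

/-- The `Fin 3` pure vector of a triple is its pure vector. [folklore] -/
private theorem fin_pureVec₃₉ (x : ℤ × ℤ × ℤ) :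
    (⟨0, ((![x.1, x.2.1, x.2.2] : Fin 3 → ℤ) 0 : ℚ), ((![x.1, x.2.1, x.2.2] : Fin 3 → ℤ) 1 : ℚ),
      ((![x.1, x.2.1, x.2.2] : Fin 3 → ℤ) 2 : ℚ)⟩ : ℍ[ℚ,((-1 : ℤ) : ℚ),((3 : ℤ) : ℚ)]) = ⟨0, x.1, x.2.1, x.2.2⟩ := rfl

/-- The `Fin 3` norm form of a triple is its norm form. [folklore] -/
private theorem fin_normForm₃₉ (x : ℤ × ℤ × ℤ) :
    (![x.1, x.2.1, x.2.2] : Fin 3 → ℤ) 0 ^ 2 - 3 * (![x.1, x.2.1, x.2.2] : Fin 3 → ℤ) 1 ^ 2 -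
      3 * (![x.1, x.2.1, x.2.2] : Fin 3 → ℤ) 2 ^ 2 = x.1 ^ 2 - 3 * x.2.1 ^ 2 - 3 * x.2.2 ^ 2 := rfl

/-- `Squarefree t`, `c ≠ 1` ⟹ `c²·Q ≠ t`. [folklore] -/
private theorem ne_of_squarefree₃₉ {t : ℤ} (ht : Squarefree t) {c : ℕ} (hc : c ≠ 1) (Qx : ℤ) : (c : ℤ) ^ 2 * Qx ≠ t := by
  intro e
  have hd : (c : ℤ) * (c : ℤ) ∣ t := ⟨Qx, by rw [← e, sq]⟩
  have hu := Int.isUnit_iff.1 (ht _ hd)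
  omega

/-- A content `c` of a vector of `L(t)`, `t > 0`, lies in `[1, t]`. [folklore] -/
private theorem content_mem_Icc₃₉ {t : ℤ} (ht : 0 < t) {c : ℕ} (hc : 0 < c) {Qx : ℤ} (e : (c : ℤ) ^ 2 * Qx = t) :
    c ∈ Finset.Icc 1 t.toNat := by
  rw [Finset.mem_Icc]
  refine ⟨hc, ?_⟩
  have hc1 : (1 : ℤ) ≤ c := by exact_mod_cast hc
  have hQ : 0 < Qx := by
    by_contra hle
    have : (c : ℤ) ^ 2 * Qx ≤ 0 := mul_nonpos_of_nonneg_of_nonpos (sq_nonneg _) (not_lt.1 hle)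
    omega
  have h1 : (c : ℤ) ≤ t := by nlinarith
  have h2 : (c : ℤ) ≤ (t.toNat : ℤ) := by rwa [Int.toNat_of_nonneg ht.le]
  exact_mod_cast h2

/-- **The content is an `O₆^×`-invariant** (triple form of `unitMulAtkinLehner_conj_content_iff` with `k = l = 0`): for
`g ∈ O₆`, `nr g = ±1`, `c ≥ 1`, `p̂, p̂'` primitive, `g·(c·p̂) = (c'·p̂')·g ⟹ c = c' ∧ g·p̂ = p̂'·g`.
[cite: VignerasLNM800, Ch. I §4 p. 26 («`C(h,B)` est stable pour l'opération à gauche de `G̃`»)] [cite: KudlaRapoportYang2006, §3.4 (3.4.6)] -/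
private theorem content_eq_of_unit_conj₃₉ {g : ℍ[ℚ,((-1 : ℤ) : ℚ),((3 : ℤ) : ℚ)]} (hg : (g ∈ order (-1) 3 ∨ g - ⟨1/2, 1/2, 1/2, -1/2⟩ ∈ order (-1) 3)) (hn : ((g * star g).re = 1 ∨ (g * star g).re = -1))
    {c c' : ℕ} (hc : 0 < c) {x x' : ℤ × ℤ × ℤ}
    (hx : ∃ u : ℤ × ℤ × ℤ, u.1 * x.1 + u.2.1 * x.2.1 + u.2.2 * x.2.2 = 1)
    (hx' : ∃ u : ℤ × ℤ × ℤ, u.1 * x'.1 + u.2.1 * x'.2.1 + u.2.2 * x'.2.2 = 1)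
    (h : g * ((c : ℚ) • (⟨0, x.1, x.2.1, x.2.2⟩ : ℍ[ℚ,((-1 : ℤ) : ℚ),((3 : ℤ) : ℚ)])) = ((c' : ℚ) • (⟨0, x'.1, x'.2.1, x'.2.2⟩ : ℍ[ℚ,((-1 : ℤ) : ℚ),((3 : ℤ) : ℚ)])) * g) :
    c = c' ∧ g * (⟨0, x.1, x.2.1, x.2.2⟩ : ℍ[ℚ,((-1 : ℤ) : ℚ),((3 : ℤ) : ℚ)]) = (⟨0, x'.1, x'.2.1, x'.2.2⟩ : ℍ[ℚ,((-1 : ℤ) : ℚ),((3 : ℤ) : ℚ)]) * g := by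
  have h1 : g * star g = 1 ∨ g * star g = -1 := by
    rcases hn with hn | hn
    · exact Or.inl (by rw [QuaternionAlgebra.mul_star_eq_coe, hn, QuaternionAlgebra.coe_one])
    · exact Or.inr (by rw [QuaternionAlgebra.mul_star_eq_coe, hn, QuaternionAlgebra.coe_neg, QuaternionAlgebra.coe_one])
  have e := unitMulAtkinLehner_conj_content_iff (c' := c') hg h1 0 0 hc (prim_fin₃₉ hx) (prim_fin₃₉ hx')
  rw [fin_pureVec₃₉, fin_pureVec₃₉] at e
  simp only [pow_zero, mul_one] at e
  exact e.1 h

end Helpers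

/-! ## §1 `e_x` is insensitive to sign, partner, content, and to the choice of representative -/

section Invariances

/-- **`e_{−x} = e_x`**: a unit commutes with `−X` iff it commutes with `X` — the vectors `x` and `−x` have the same
stabiliser `Γ_x = Γ_{−x}` (they «contribute the same pair of points» with the same multiplicity). [cite: KudlaRapoportYang2006, §3.4 Lemma 3.4.3 (i), (3.4.14) and p. 54] -/
theorem card_unitStab_neg (X : ℍ[ℚ,((-1 : ℤ) : ℚ),((3 : ℤ) : ℚ)]) :
    Nat.card {u : ℍ[ℚ,((-1 : ℤ) : ℚ),((3 : ℤ) : ℚ)] // (u ∈ order (-1) 3 ∨ u - ⟨1/2, 1/2, 1/2, -1/2⟩ ∈ order (-1) 3) ∧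
        ((u * star u).re = 1 ∨ (u * star u).re = -1) ∧ u * (-X) = (-X) * u} = Nat.card {u : ℍ[ℚ,((-1 : ℤ) : ℚ),((3 : ℤ) : ℚ)] // (u ∈ order (-1) 3 ∨ u - ⟨1/2, 1/2, 1/2, -1/2⟩ ∈ order (-1) 3) ∧
        ((u * star u).re = 1 ∨ (u * star u).re = -1) ∧ u * X = X * u} :=
  Nat.card_congr (Equiv.subtypeEquivRight fun u ↦ by rw [mul_neg, neg_mul, neg_inj])

/-- **`e_{c·x} = e_x` for `c ∈ ℚ^×`**: the stabiliser sees only the line `ℚx̂`, i.e. the CM field `ℚ(x̂)`; in particular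
`e` of a vector of content `c` is `e` of its primitive part. [cite: KudlaRapoportYang2006, §3.4 (3.4.6) («the order `O_{c²d}` of conductor `c`») and (3.4.14)] -/
theorem card_unitStab_smul {c : ℚ} (hc : c ≠ 0) (X : ℍ[ℚ,((-1 : ℤ) : ℚ),((3 : ℤ) : ℚ)]) :
    Nat.card {u : ℍ[ℚ,((-1 : ℤ) : ℚ),((3 : ℤ) : ℚ)] // (u ∈ order (-1) 3 ∨ u - ⟨1/2, 1/2, 1/2, -1/2⟩ ∈ order (-1) 3) ∧
        ((u * star u).re = 1 ∨ (u * star u).re = -1) ∧ u * (c • X) = (c • X) * u} = Nat.card {u : ℍ[ℚ,((-1 : ℤ) : ℚ),((3 : ℤ) : ℚ)] // (u ∈ order (-1) 3 ∨ u - ⟨1/2, 1/2, 1/2, -1/2⟩ ∈ order (-1) 3) ∧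
        ((u * star u).re = 1 ∨ (u * star u).re = -1) ∧ u * X = X * u} :=
  Nat.card_congr (Equiv.subtypeEquivRight fun u ↦ by rw [conj_ratSmul_iff hc])

/-- **`e_{x^e} = e_x` for the partner `x^e = Ad(e)x = (−2x₁ + 3x₂, −x₃, x₁ − 2x₂)`**: `ē ∈ O₆^×` (norm `−1`) conjugates
`x̂^e` to `x̂` (`star_e_conj_partner`), and `e` is a class function under all of `O₆^×` (`card_unitStab_eq_of_conj`) — the two
`Γ₆`-classes `[x̂], [x̂^e]` over one `O₆^×`-class carry the same weight. [cite: KudlaRapoportYang2006, §3.2 p. 48 («`Γ = O_B^×`») and §3.4 (3.4.14)] [cite: VignerasLNM800, Ch. III §5.C Cor. 5.13] -/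
theorem card_unitStab_partner (x₁ x₂ x₃ : ℤ) :
    Nat.card {u : ℍ[ℚ,((-1 : ℤ) : ℚ),((3 : ℤ) : ℚ)] // (u ∈ order (-1) 3 ∨ u - ⟨1/2, 1/2, 1/2, -1/2⟩ ∈ order (-1) 3) ∧
        ((u * star u).re = 1 ∨ (u * star u).re = -1) ∧ u * (⟨0, ((-2 * x₁ + 3 * x₂ : ℤ) : ℚ), ((-x₃ : ℤ) : ℚ), ((x₁ - 2 * x₂ : ℤ) : ℚ)⟩ : ℍ[ℚ,((-1 : ℤ) : ℚ),((3 : ℤ) : ℚ)]) = (⟨0, ((-2 * x₁ + 3 * x₂ : ℤ) : ℚ), ((-x₃ : ℤ) : ℚ), ((x₁ - 2 * x₂ : ℤ) : ℚ)⟩ : ℍ[ℚ,((-1 : ℤ) : ℚ),((3 : ℤ) : ℚ)]) * u} =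
    Nat.card {u : ℍ[ℚ,((-1 : ℤ) : ℚ),((3 : ℤ) : ℚ)] // (u ∈ order (-1) 3 ∨ u - ⟨1/2, 1/2, 1/2, -1/2⟩ ∈ order (-1) 3) ∧
        ((u * star u).re = 1 ∨ (u * star u).re = -1) ∧ u * (⟨0, x₁, x₂, x₃⟩ : ℍ[ℚ,((-1 : ℤ) : ℚ),((3 : ℤ) : ℚ)]) = (⟨0, x₁, x₂, x₃⟩ : ℍ[ℚ,((-1 : ℤ) : ℚ),((3 : ℤ) : ℚ)]) * u} := by
  obtain ⟨hm, hn, hc⟩ := star_e_conj_partner x₁ x₂ x₃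
  exact card_unitStab_eq_of_conj (star_pureVec₃₉ _ _ _) (star_pureVec₃₉ _ _ _) hm hn hc

/-- **`e` is constant on `Γ₆ = O₆¹`-classes**: if `u ∈ Γ₆` conjugates `X` to `Y` (both pure) then `|Γ_X| = |Γ_Y|` — a
special case of `card_unitStab_eq_of_conj` (`Γ₆ ⊂ O₆^×`). [cite: KudlaRapoportYang2006, §3.4 (3.4.13)–(3.4.14)] [cite: BayerTravesa2007, §1 Thm. 1.1 (`Γ₆ = O₆¹`)] -/
theorem card_unitStab_eq_of_normOne_conj {X Y u : ℍ[ℚ,((-1 : ℤ) : ℚ),((3 : ℤ) : ℚ)]} (hX : star X = -X) (hY : star Y = -Y)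
    (hu : (u ∈ order (-1) 3 ∨ u - ⟨1/2, 1/2, 1/2, -1/2⟩ ∈ order (-1) 3)) (hn : (u * star u).re = 1) (hc : u * X = Y * u) :
    Nat.card {u : ℍ[ℚ,((-1 : ℤ) : ℚ),((3 : ℤ) : ℚ)] // (u ∈ order (-1) 3 ∨ u - ⟨1/2, 1/2, 1/2, -1/2⟩ ∈ order (-1) 3) ∧
        ((u * star u).re = 1 ∨ (u * star u).re = -1) ∧ u * X = X * u} =
    Nat.card {u : ℍ[ℚ,((-1 : ℤ) : ℚ),((3 : ℤ) : ℚ)] // (u ∈ order (-1) 3 ∨ u - ⟨1/2, 1/2, 1/2, -1/2⟩ ∈ order (-1) 3) ∧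
        ((u * star u).re = 1 ∨ (u * star u).re = -1) ∧ u * Y = Y * u} :=
  card_unitStab_eq_of_conj hX hY hu (Or.inl hn) hc

/-- **`e` at a representative of a `Γ₆`-class**: for `[x] ∈ L(t)/Γ₆`, the stabiliser order of (the vector of) `Quot.out [x]`
is that of `x`. [cite: KudlaRapoportYang2006, §3.4 (3.4.13)–(3.4.14)] -/
theorem card_unitStab_normOne_mk_out (t : ℤ) (x : {x : ℤ × ℤ × ℤ // x.1 ^ 2 - 3 * x.2.1 ^ 2 - 3 * x.2.2 ^ 2 = t}) :
    Nat.card {u : ℍ[ℚ,((-1 : ℤ) : ℚ),((3 : ℤ) : ℚ)] // (u ∈ order (-1) 3 ∨ u - ⟨1/2, 1/2, 1/2, -1/2⟩ ∈ order (-1) 3) ∧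
        ((u * star u).re = 1 ∨ (u * star u).re = -1) ∧ u * (⟨0, ((Quot.mk _ x : (Quot (fun x y : {x : ℤ × ℤ × ℤ // x.1 ^ 2 - 3 * x.2.1 ^ 2 - 3 * x.2.2 ^ 2 = t} ↦
      ∃ u : ℍ[ℚ,((-1 : ℤ) : ℚ),((3 : ℤ) : ℚ)], (u ∈ order (-1) 3 ∨ u - ⟨1/2, 1/2, 1/2, -1/2⟩ ∈ order (-1) 3) ∧
        (u * star u).re = 1 ∧ u * ⟨0, x.1.1, x.1.2.1, x.1.2.2⟩ = ⟨0, y.1.1, y.1.2.1, y.1.2.2⟩ * u))).out).1.1, ((Quot.mk _ x : (Quot (fun x y : {x : ℤ × ℤ × ℤ // x.1 ^ 2 - 3 * x.2.1 ^ 2 - 3 * x.2.2 ^ 2 = t} ↦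
      ∃ u : ℍ[ℚ,((-1 : ℤ) : ℚ),((3 : ℤ) : ℚ)], (u ∈ order (-1) 3 ∨ u - ⟨1/2, 1/2, 1/2, -1/2⟩ ∈ order (-1) 3) ∧
        (u * star u).re = 1 ∧ u * ⟨0, x.1.1, x.1.2.1, x.1.2.2⟩ = ⟨0, y.1.1, y.1.2.1, y.1.2.2⟩ * u))).out).1.2.1, ((Quot.mk _ x : (Quot (fun x y : {x : ℤ × ℤ × ℤ // x.1 ^ 2 - 3 * x.2.1 ^ 2 - 3 * x.2.2 ^ 2 = t} ↦
      ∃ u : ℍ[ℚ,((-1 : ℤ) : ℚ),((3 : ℤ) : ℚ)], (u ∈ order (-1) 3 ∨ u - ⟨1/2, 1/2, 1/2, -1/2⟩ ∈ order (-1) 3) ∧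
        (u * star u).re = 1 ∧ u * ⟨0, x.1.1, x.1.2.1, x.1.2.2⟩ = ⟨0, y.1.1, y.1.2.1, y.1.2.2⟩ * u))).out).1.2.2⟩ : ℍ[ℚ,((-1 : ℤ) : ℚ),((3 : ℤ) : ℚ)]) = (⟨0, ((Quot.mk _ x : (Quot (fun x y : {x : ℤ × ℤ × ℤ // x.1 ^ 2 - 3 * x.2.1 ^ 2 - 3 * x.2.2 ^ 2 = t} ↦
      ∃ u : ℍ[ℚ,((-1 : ℤ) : ℚ),((3 : ℤ) : ℚ)], (u ∈ order (-1) 3 ∨ u - ⟨1/2, 1/2, 1/2, -1/2⟩ ∈ order (-1) 3) ∧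
        (u * star u).re = 1 ∧ u * ⟨0, x.1.1, x.1.2.1, x.1.2.2⟩ = ⟨0, y.1.1, y.1.2.1, y.1.2.2⟩ * u))).out).1.1, ((Quot.mk _ x : (Quot (fun x y : {x : ℤ × ℤ × ℤ // x.1 ^ 2 - 3 * x.2.1 ^ 2 - 3 * x.2.2 ^ 2 = t} ↦
      ∃ u : ℍ[ℚ,((-1 : ℤ) : ℚ),((3 : ℤ) : ℚ)], (u ∈ order (-1) 3 ∨ u - ⟨1/2, 1/2, 1/2, -1/2⟩ ∈ order (-1) 3) ∧
        (u * star u).re = 1 ∧ u * ⟨0, x.1.1, x.1.2.1, x.1.2.2⟩ = ⟨0, y.1.1, y.1.2.1, y.1.2.2⟩ * u))).out).1.2.1, ((Quot.mk _ x : (Quot (fun x y : {x : ℤ × ℤ × ℤ // x.1 ^ 2 - 3 * x.2.1 ^ 2 - 3 * x.2.2 ^ 2 = t} ↦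
      ∃ u : ℍ[ℚ,((-1 : ℤ) : ℚ),((3 : ℤ) : ℚ)], (u ∈ order (-1) 3 ∨ u - ⟨1/2, 1/2, 1/2, -1/2⟩ ∈ order (-1) 3) ∧
        (u * star u).re = 1 ∧ u * ⟨0, x.1.1, x.1.2.1, x.1.2.2⟩ = ⟨0, y.1.1, y.1.2.1, y.1.2.2⟩ * u))).out).1.2.2⟩ : ℍ[ℚ,((-1 : ℤ) : ℚ),((3 : ℤ) : ℚ)]) * u} =
    Nat.card {u : ℍ[ℚ,((-1 : ℤ) : ℚ),((3 : ℤ) : ℚ)] // (u ∈ order (-1) 3 ∨ u - ⟨1/2, 1/2, 1/2, -1/2⟩ ∈ order (-1) 3) ∧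
        ((u * star u).re = 1 ∨ (u * star u).re = -1) ∧ u * (⟨0, x.1.1, x.1.2.1, x.1.2.2⟩ : ℍ[ℚ,((-1 : ℤ) : ℚ),((3 : ℤ) : ℚ)]) = (⟨0, x.1.1, x.1.2.1, x.1.2.2⟩ : ℍ[ℚ,((-1 : ℤ) : ℚ),((3 : ℤ) : ℚ)]) * u} := by
  obtain ⟨u, hu, hn, hc⟩ := (normOne_conj_mk_eq_iff t _ x).1 (Quot.out_eq (Quot.mk _ x : (Quot (fun x y : {x : ℤ × ℤ × ℤ // x.1 ^ 2 - 3 * x.2.1 ^ 2 - 3 * x.2.2 ^ 2 = t} ↦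
      ∃ u : ℍ[ℚ,((-1 : ℤ) : ℚ),((3 : ℤ) : ℚ)], (u ∈ order (-1) 3 ∨ u - ⟨1/2, 1/2, 1/2, -1/2⟩ ∈ order (-1) 3) ∧
        (u * star u).re = 1 ∧ u * ⟨0, x.1.1, x.1.2.1, x.1.2.2⟩ = ⟨0, y.1.1, y.1.2.1, y.1.2.2⟩ * u))))
  exact card_unitStab_eq_of_conj (star_pureVec₃₉ _ _ _) (star_pureVec₃₉ _ _ _) hu (Or.inl hn) hc

/-- **`e` at a representative of a sign class**: for `{±[x]} ∈ L(t)/±O₆^×`, the stabiliser order of (the vector of)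
`Quot.out` is that of `x` (`v` conjugates the representative to `x̂` or to `−x̂`, and `e_{−x} = e_x`). [cite: KudlaRapoportYang2006, §3.4 Lemma 3.4.3 (i) and p. 54] -/
theorem card_unitStab_unitSign_mk_out (t : ℤ) (x : {x : ℤ × ℤ × ℤ // x.1 ^ 2 - 3 * x.2.1 ^ 2 - 3 * x.2.2 ^ 2 = t}) :
    Nat.card {u : ℍ[ℚ,((-1 : ℤ) : ℚ),((3 : ℤ) : ℚ)] // (u ∈ order (-1) 3 ∨ u - ⟨1/2, 1/2, 1/2, -1/2⟩ ∈ order (-1) 3) ∧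
        ((u * star u).re = 1 ∨ (u * star u).re = -1) ∧ u * (⟨0, ((Quot.mk _ x : (Quot (fun x y : {x : ℤ × ℤ × ℤ // x.1 ^ 2 - 3 * x.2.1 ^ 2 - 3 * x.2.2 ^ 2 = t} ↦
      ∃ v : ℍ[ℚ,((-1 : ℤ) : ℚ),((3 : ℤ) : ℚ)], (v ∈ order (-1) 3 ∨ v - ⟨1/2, 1/2, 1/2, -1/2⟩ ∈ order (-1) 3) ∧
        ((v * star v).re = 1 ∨ (v * star v).re = -1) ∧
        (v * ⟨0, x.1.1, x.1.2.1, x.1.2.2⟩ = ⟨0, y.1.1, y.1.2.1, y.1.2.2⟩ * v ∨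
          v * ⟨0, x.1.1, x.1.2.1, x.1.2.2⟩ = -(⟨0, y.1.1, y.1.2.1, y.1.2.2⟩ * v))))).out).1.1, ((Quot.mk _ x : (Quot (fun x y : {x : ℤ × ℤ × ℤ // x.1 ^ 2 - 3 * x.2.1 ^ 2 - 3 * x.2.2 ^ 2 = t} ↦
      ∃ v : ℍ[ℚ,((-1 : ℤ) : ℚ),((3 : ℤ) : ℚ)], (v ∈ order (-1) 3 ∨ v - ⟨1/2, 1/2, 1/2, -1/2⟩ ∈ order (-1) 3) ∧
        ((v * star v).re = 1 ∨ (v * star v).re = -1) ∧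
        (v * ⟨0, x.1.1, x.1.2.1, x.1.2.2⟩ = ⟨0, y.1.1, y.1.2.1, y.1.2.2⟩ * v ∨
          v * ⟨0, x.1.1, x.1.2.1, x.1.2.2⟩ = -(⟨0, y.1.1, y.1.2.1, y.1.2.2⟩ * v))))).out).1.2.1, ((Quot.mk _ x : (Quot (fun x y : {x : ℤ × ℤ × ℤ // x.1 ^ 2 - 3 * x.2.1 ^ 2 - 3 * x.2.2 ^ 2 = t} ↦
      ∃ v : ℍ[ℚ,((-1 : ℤ) : ℚ),((3 : ℤ) : ℚ)], (v ∈ order (-1) 3 ∨ v - ⟨1/2, 1/2, 1/2, -1/2⟩ ∈ order (-1) 3) ∧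
        ((v * star v).re = 1 ∨ (v * star v).re = -1) ∧
        (v * ⟨0, x.1.1, x.1.2.1, x.1.2.2⟩ = ⟨0, y.1.1, y.1.2.1, y.1.2.2⟩ * v ∨
          v * ⟨0, x.1.1, x.1.2.1, x.1.2.2⟩ = -(⟨0, y.1.1, y.1.2.1, y.1.2.2⟩ * v))))).out).1.2.2⟩ : ℍ[ℚ,((-1 : ℤ) : ℚ),((3 : ℤ) : ℚ)]) = (⟨0, ((Quot.mk _ x : (Quot (fun x y : {x : ℤ × ℤ × ℤ // x.1 ^ 2 - 3 * x.2.1 ^ 2 - 3 * x.2.2 ^ 2 = t} ↦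
      ∃ v : ℍ[ℚ,((-1 : ℤ) : ℚ),((3 : ℤ) : ℚ)], (v ∈ order (-1) 3 ∨ v - ⟨1/2, 1/2, 1/2, -1/2⟩ ∈ order (-1) 3) ∧
        ((v * star v).re = 1 ∨ (v * star v).re = -1) ∧
        (v * ⟨0, x.1.1, x.1.2.1, x.1.2.2⟩ = ⟨0, y.1.1, y.1.2.1, y.1.2.2⟩ * v ∨
          v * ⟨0, x.1.1, x.1.2.1, x.1.2.2⟩ = -(⟨0, y.1.1, y.1.2.1, y.1.2.2⟩ * v))))).out).1.1, ((Quot.mk _ x : (Quot (fun x y : {x : ℤ × ℤ × ℤ // x.1 ^ 2 - 3 * x.2.1 ^ 2 - 3 * x.2.2 ^ 2 = t} ↦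
      ∃ v : ℍ[ℚ,((-1 : ℤ) : ℚ),((3 : ℤ) : ℚ)], (v ∈ order (-1) 3 ∨ v - ⟨1/2, 1/2, 1/2, -1/2⟩ ∈ order (-1) 3) ∧
        ((v * star v).re = 1 ∨ (v * star v).re = -1) ∧
        (v * ⟨0, x.1.1, x.1.2.1, x.1.2.2⟩ = ⟨0, y.1.1, y.1.2.1, y.1.2.2⟩ * v ∨
          v * ⟨0, x.1.1, x.1.2.1, x.1.2.2⟩ = -(⟨0, y.1.1, y.1.2.1, y.1.2.2⟩ * v))))).out).1.2.1, ((Quot.mk _ x : (Quot (fun x y : {x : ℤ × ℤ × ℤ // x.1 ^ 2 - 3 * x.2.1 ^ 2 - 3 * x.2.2 ^ 2 = t} ↦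
      ∃ v : ℍ[ℚ,((-1 : ℤ) : ℚ),((3 : ℤ) : ℚ)], (v ∈ order (-1) 3 ∨ v - ⟨1/2, 1/2, 1/2, -1/2⟩ ∈ order (-1) 3) ∧
        ((v * star v).re = 1 ∨ (v * star v).re = -1) ∧
        (v * ⟨0, x.1.1, x.1.2.1, x.1.2.2⟩ = ⟨0, y.1.1, y.1.2.1, y.1.2.2⟩ * v ∨
          v * ⟨0, x.1.1, x.1.2.1, x.1.2.2⟩ = -(⟨0, y.1.1, y.1.2.1, y.1.2.2⟩ * v))))).out).1.2.2⟩ : ℍ[ℚ,((-1 : ℤ) : ℚ),((3 : ℤ) : ℚ)]) * u} =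
    Nat.card {u : ℍ[ℚ,((-1 : ℤ) : ℚ),((3 : ℤ) : ℚ)] // (u ∈ order (-1) 3 ∨ u - ⟨1/2, 1/2, 1/2, -1/2⟩ ∈ order (-1) 3) ∧
        ((u * star u).re = 1 ∨ (u * star u).re = -1) ∧ u * (⟨0, x.1.1, x.1.2.1, x.1.2.2⟩ : ℍ[ℚ,((-1 : ℤ) : ℚ),((3 : ℤ) : ℚ)]) = (⟨0, x.1.1, x.1.2.1, x.1.2.2⟩ : ℍ[ℚ,((-1 : ℤ) : ℚ),((3 : ℤ) : ℚ)]) * u} := by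
  obtain ⟨v, hv, hn, hc | hc⟩ := (unitSign_conj_mk_eq_iff t _ x).1 (Quot.out_eq (Quot.mk _ x : (Quot (fun x y : {x : ℤ × ℤ × ℤ // x.1 ^ 2 - 3 * x.2.1 ^ 2 - 3 * x.2.2 ^ 2 = t} ↦
      ∃ v : ℍ[ℚ,((-1 : ℤ) : ℚ),((3 : ℤ) : ℚ)], (v ∈ order (-1) 3 ∨ v - ⟨1/2, 1/2, 1/2, -1/2⟩ ∈ order (-1) 3) ∧
        ((v * star v).re = 1 ∨ (v * star v).re = -1) ∧
        (v * ⟨0, x.1.1, x.1.2.1, x.1.2.2⟩ = ⟨0, y.1.1, y.1.2.1, y.1.2.2⟩ * v ∨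
          v * ⟨0, x.1.1, x.1.2.1, x.1.2.2⟩ = -(⟨0, y.1.1, y.1.2.1, y.1.2.2⟩ * v))))))
  · exact card_unitStab_eq_of_conj (star_pureVec₃₉ _ _ _) (star_pureVec₃₉ _ _ _) hv hn hc
  · rw [← neg_mul] at hc
    rw [card_unitStab_eq_of_conj (star_pureVec₃₉ _ _ _) (by rw [star_neg, star_pureVec₃₉]) hv hn hc]
    exact card_unitStab_neg _

end Invariances

/-! ## §2 Three index sets, one degree: `Σᶠ_{L(t)/Γ₆} e⁻¹ = 2·Σᶠ_{L(t)/O₆^×} e⁻¹ = 4·Σᶠ_{L(t)/±O₆^×} e⁻¹` -/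

section IndexSets

/-- **`Σᶠ_{[x] ∈ L(t)/Γ₆} e_x⁻¹ = 2·Σᶠ_{[x] ∈ L(t)/O₆^×} e_x⁻¹ = deg Z(t)_ℚ` FOR EVERY `t > 0`** — Kudla–Rapoport–Yang's
degree (3.4.14), written over their `Γ = O_B^× = O₆^×` with the factor `2`, is the plain weighted count over the classes
modulo the Fuchsian group `Γ₆ = O₆¹` of `X₆ = Γ₆∖ℌ`: the surjection `L(t)/Γ₆ → L(t)/O₆^×` has the two-element fibres
`{[x̂], [x̂^e]}` (`O₆^× = Γ₆ ⊔ ēΓ₆`, `unit_conj_iff_normOne_conj_or_e_partner`; the partner involution is free,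
`e_quadruple_pairwise_not_normOne_conj`) and `e` is constant along them (`card_unitStab_partner`). This is Vignéras'
`m_{𝒪¹} = m_{𝒪^×}·[n(𝒪^×) : n(𝒪¹)n(B^×)]` (index `2` for `B = (−1,3)_ℚ`) weighted by `1/|Γ_x|`, `Γ_x ⊂ 𝒪¹`.
[cite: KudlaRapoportYang2006, §3.2 p. 48 and §3.4 (3.4.13)–(3.4.14)] [cite: VignerasLNM800, Ch. III §5.C Cor. 5.13 p. 82] [cite: BayerTravesa2007, §1 Thm. 1.1] -/
theorem finsum_normOne_classes_eq_two_mul_finsum_unit_classes {t : ℤ} (ht : 0 < t) :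
    ∑ᶠ q : (Quot (fun x y : {x : ℤ × ℤ × ℤ // x.1 ^ 2 - 3 * x.2.1 ^ 2 - 3 * x.2.2 ^ 2 = t} ↦
      ∃ u : ℍ[ℚ,((-1 : ℤ) : ℚ),((3 : ℤ) : ℚ)], (u ∈ order (-1) 3 ∨ u - ⟨1/2, 1/2, 1/2, -1/2⟩ ∈ order (-1) 3) ∧
        (u * star u).re = 1 ∧ u * ⟨0, x.1.1, x.1.2.1, x.1.2.2⟩ = ⟨0, y.1.1, y.1.2.1, y.1.2.2⟩ * u)),
        ((Nat.card
          {u : ℍ[ℚ,((-1 : ℤ) : ℚ),((3 : ℤ) : ℚ)] // (u ∈ order (-1) 3 ∨ u - ⟨1/2, 1/2, 1/2, -1/2⟩ ∈ order (-1) 3) ∧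
            ((u * star u).re = 1 ∨ (u * star u).re = -1) ∧
            u * ⟨0, q.out.1.1, q.out.1.2.1, q.out.1.2.2⟩ = ⟨0, q.out.1.1, q.out.1.2.1, q.out.1.2.2⟩ * u} : ℚ))⁻¹ =
    2 * ∑ᶠ q : (Quot (fun x y : {x : ℤ × ℤ × ℤ // x.1 ^ 2 - 3 * x.2.1 ^ 2 - 3 * x.2.2 ^ 2 = t} ↦
      ∃ v : ℍ[ℚ,((-1 : ℤ) : ℚ),((3 : ℤ) : ℚ)], (v ∈ order (-1) 3 ∨ v - ⟨1/2, 1/2, 1/2, -1/2⟩ ∈ order (-1) 3) ∧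
        ((v * star v).re = 1 ∨ (v * star v).re = -1) ∧
        v * ⟨0, x.1.1, x.1.2.1, x.1.2.2⟩ = ⟨0, y.1.1, y.1.2.1, y.1.2.2⟩ * v)),
        ((Nat.card
          {u : ℍ[ℚ,((-1 : ℤ) : ℚ),((3 : ℤ) : ℚ)] // (u ∈ order (-1) 3 ∨ u - ⟨1/2, 1/2, 1/2, -1/2⟩ ∈ order (-1) 3) ∧
            ((u * star u).re = 1 ∨ (u * star u).re = -1) ∧
            u * ⟨0, q.out.1.1, q.out.1.2.1, q.out.1.2.2⟩ = ⟨0, q.out.1.1, q.out.1.2.1, q.out.1.2.2⟩ * u} : ℚ))⁻¹ := by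
  have hfin := finite_normOne_classes ht
  set R : {x : ℤ × ℤ × ℤ // x.1 ^ 2 - 3 * x.2.1 ^ 2 - 3 * x.2.2 ^ 2 = t} → {x : ℤ × ℤ × ℤ // x.1 ^ 2 - 3 * x.2.1 ^ 2 - 3 * x.2.2 ^ 2 = t} → Prop := (fun x y : {x : ℤ × ℤ × ℤ // x.1 ^ 2 - 3 * x.2.1 ^ 2 - 3 * x.2.2 ^ 2 = t} ↦
      ∃ u : ℍ[ℚ,((-1 : ℤ) : ℚ),((3 : ℤ) : ℚ)], (u ∈ order (-1) 3 ∨ u - ⟨1/2, 1/2, 1/2, -1/2⟩ ∈ order (-1) 3) ∧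
        (u * star u).re = 1 ∧ u * ⟨0, x.1.1, x.1.2.1, x.1.2.2⟩ = ⟨0, y.1.1, y.1.2.1, y.1.2.2⟩ * u) with hR
  set R' : {x : ℤ × ℤ × ℤ // x.1 ^ 2 - 3 * x.2.1 ^ 2 - 3 * x.2.2 ^ 2 = t} → {x : ℤ × ℤ × ℤ // x.1 ^ 2 - 3 * x.2.1 ^ 2 - 3 * x.2.2 ^ 2 = t} → Prop := (fun x y : {x : ℤ × ℤ × ℤ // x.1 ^ 2 - 3 * x.2.1 ^ 2 - 3 * x.2.2 ^ 2 = t} ↦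
      ∃ v : ℍ[ℚ,((-1 : ℤ) : ℚ),((3 : ℤ) : ℚ)], (v ∈ order (-1) 3 ∨ v - ⟨1/2, 1/2, 1/2, -1/2⟩ ∈ order (-1) 3) ∧
        ((v * star v).re = 1 ∨ (v * star v).re = -1) ∧
        v * ⟨0, x.1.1, x.1.2.1, x.1.2.2⟩ = ⟨0, y.1.1, y.1.2.1, y.1.2.2⟩ * v) with hR'
  haveI : Finite (Quot R) := hfin
  have hE : Equivalence R := normOne_conj_equivalence t
  have hiff : ∀ x y, Quot.mk R x = Quot.mk R y ↔ R x y := normOne_conj_mk_eq_iff t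
  have hiff' : ∀ x y, Quot.mk R' x = Quot.mk R' y ↔ R' x y := unit_conj_mk_eq_iff t
  have hsub : ∀ x y, R x y → R' x y := by
    rintro x y ⟨u, hu, hn, h⟩
    simp only [hR']
    exact ⟨u, hu, Or.inl hn, h⟩
  -- the partner map `x ↦ x^e` on vectors and on `Γ₆`-classes
  set pa : {x : ℤ × ℤ × ℤ // x.1 ^ 2 - 3 * x.2.1 ^ 2 - 3 * x.2.2 ^ 2 = t} → {x : ℤ × ℤ × ℤ // x.1 ^ 2 - 3 * x.2.1 ^ 2 - 3 * x.2.2 ^ 2 = t} :=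
    fun x ↦ ⟨(-2 * x.1.1 + 3 * x.1.2.1, -x.1.2.2, x.1.1 - 2 * x.1.2.1), by
      show (-2 * x.1.1 + 3 * x.1.2.1) ^ 2 - 3 * (-x.1.2.2) ^ 2 - 3 * (x.1.1 - 2 * x.1.2.1) ^ 2 = t
      linear_combination x.2⟩ with hpa
  have cpa : ∀ x y, R x y → R (pa x) (pa y) := by
    rintro x y ⟨u, hu, hn, h⟩
    simp only [hR, hpa]
    exact exists_normOne_conj_partner hu hn h
  have hQ : ∀ x : {x : ℤ × ℤ × ℤ // x.1 ^ 2 - 3 * x.2.1 ^ 2 - 3 * x.2.2 ^ 2 = t}, 0 < x.1.1 ^ 2 - 3 * x.1.2.1 ^ 2 - 3 * x.1.2.2 ^ 2 := fun x ↦ by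
    have hx : x.1.1 ^ 2 - 3 * x.1.2.1 ^ 2 - 3 * x.1.2.2 ^ 2 = t := x.2
    rw [hx]; exact ht
  -- `O₆^×`-conjugacy = `Γ₆`-conjugacy of `x` or of `x^e`, read on the subtype
  have hsplit : ∀ x y : {x : ℤ × ℤ × ℤ // x.1 ^ 2 - 3 * x.2.1 ^ 2 - 3 * x.2.2 ^ 2 = t}, R' x y → R x y ∨ R (pa x) y := by
    intro x y h
    have key := (unit_conj_iff_normOne_conj_or_e_partner ![x.1.1, x.1.2.1, x.1.2.2] (⟨0, y.1.1, y.1.2.1, y.1.2.2⟩ : ℍ[ℚ,((-1 : ℤ) : ℚ),((3 : ℤ) : ℚ)])).1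
    simp only [Matrix.cons_val_zero, Matrix.cons_val_one, Matrix.cons_val_two, Matrix.head_cons, Matrix.tail_cons]
      at key
    simp only [hR'] at h
    simp only [hR, hpa]
    exact key h
  have hππ : ∀ q : Quot R, Quot.map pa cpa (Quot.map pa cpa q) = q := by
    intro q
    induction q using Quot.ind with
    | _ x =>
      show Quot.mk R (pa (pa x)) = Quot.mk R x
      rw [hiff]
      apply hE.symm
      simp only [hR, hpa]
      obtain ⟨⟨he, hn⟩, h⟩ := e_sq_conj_partner_partner x.1.1 x.1.2.1 x.1.2.2
      exact ⟨_, he, hn, h⟩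
  -- `e` at representatives
  have hout : ∀ x : {x : ℤ × ℤ × ℤ // x.1 ^ 2 - 3 * x.2.1 ^ 2 - 3 * x.2.2 ^ 2 = t}, Nat.card {u : ℍ[ℚ,((-1 : ℤ) : ℚ),((3 : ℤ) : ℚ)] // (u ∈ order (-1) 3 ∨ u - ⟨1/2, 1/2, 1/2, -1/2⟩ ∈ order (-1) 3) ∧ ((u * star u).re = 1 ∨ (u * star u).re = -1) ∧ u * (⟨0, ((Quot.mk R x).out).1.1, ((Quot.mk R x).out).1.2.1, ((Quot.mk R x).out).1.2.2⟩ : ℍ[ℚ,((-1 : ℤ) : ℚ),((3 : ℤ) : ℚ)]) = (⟨0, ((Quot.mk R x).out).1.1, ((Quot.mk R x).out).1.2.1, ((Quot.mk R x).out).1.2.2⟩ : ℍ[ℚ,((-1 : ℤ) : ℚ),((3 : ℤ) : ℚ)]) * u} =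
      Nat.card {u : ℍ[ℚ,((-1 : ℤ) : ℚ),((3 : ℤ) : ℚ)] // (u ∈ order (-1) 3 ∨ u - ⟨1/2, 1/2, 1/2, -1/2⟩ ∈ order (-1) 3) ∧ ((u * star u).re = 1 ∨ (u * star u).re = -1) ∧ u * (⟨0, x.1.1, x.1.2.1, x.1.2.2⟩ : ℍ[ℚ,((-1 : ℤ) : ℚ),((3 : ℤ) : ℚ)]) = (⟨0, x.1.1, x.1.2.1, x.1.2.2⟩ : ℍ[ℚ,((-1 : ℤ) : ℚ),((3 : ℤ) : ℚ)]) * u} := card_unitStab_normOne_mk_out t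
  have hout' : ∀ x : {x : ℤ × ℤ × ℤ // x.1 ^ 2 - 3 * x.2.1 ^ 2 - 3 * x.2.2 ^ 2 = t}, Nat.card {u : ℍ[ℚ,((-1 : ℤ) : ℚ),((3 : ℤ) : ℚ)] // (u ∈ order (-1) 3 ∨ u - ⟨1/2, 1/2, 1/2, -1/2⟩ ∈ order (-1) 3) ∧ ((u * star u).re = 1 ∨ (u * star u).re = -1) ∧ u * (⟨0, ((Quot.mk R' x).out).1.1, ((Quot.mk R' x).out).1.2.1, ((Quot.mk R' x).out).1.2.2⟩ : ℍ[ℚ,((-1 : ℤ) : ℚ),((3 : ℤ) : ℚ)]) = (⟨0, ((Quot.mk R' x).out).1.1, ((Quot.mk R' x).out).1.2.1, ((Quot.mk R' x).out).1.2.2⟩ : ℍ[ℚ,((-1 : ℤ) : ℚ),((3 : ℤ) : ℚ)]) * u} =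
      Nat.card {u : ℍ[ℚ,((-1 : ℤ) : ℚ),((3 : ℤ) : ℚ)] // (u ∈ order (-1) 3 ∨ u - ⟨1/2, 1/2, 1/2, -1/2⟩ ∈ order (-1) 3) ∧ ((u * star u).re = 1 ∨ (u * star u).re = -1) ∧ u * (⟨0, x.1.1, x.1.2.1, x.1.2.2⟩ : ℍ[ℚ,((-1 : ℤ) : ℚ),((3 : ℤ) : ℚ)]) = (⟨0, x.1.1, x.1.2.1, x.1.2.2⟩ : ℍ[ℚ,((-1 : ℤ) : ℚ),((3 : ℤ) : ℚ)]) * u} := card_unitStab_mk_out t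
  -- the comparison map `L(t)/Γ₆ → L(t)/O₆^×` and the weight
  let f : Quot R → Quot R' := Quot.lift (Quot.mk R') fun x y h ↦ Quot.sound (hsub x y h)
  have hcongr : ∀ q : Quot R, ((Nat.card
          {u : ℍ[ℚ,((-1 : ℤ) : ℚ),((3 : ℤ) : ℚ)] // (u ∈ order (-1) 3 ∨ u - ⟨1/2, 1/2, 1/2, -1/2⟩ ∈ order (-1) 3) ∧
            ((u * star u).re = 1 ∨ (u * star u).re = -1) ∧
            u * ⟨0, q.out.1.1, q.out.1.2.1, q.out.1.2.2⟩ = ⟨0, q.out.1.1, q.out.1.2.1, q.out.1.2.2⟩ * u} : ℚ))⁻¹ =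
      (fun q' : Quot R' ↦ ((Nat.card
          {u : ℍ[ℚ,((-1 : ℤ) : ℚ),((3 : ℤ) : ℚ)] // (u ∈ order (-1) 3 ∨ u - ⟨1/2, 1/2, 1/2, -1/2⟩ ∈ order (-1) 3) ∧
            ((u * star u).re = 1 ∨ (u * star u).re = -1) ∧
            u * ⟨0, q'.out.1.1, q'.out.1.2.1, q'.out.1.2.2⟩ = ⟨0, q'.out.1.1, q'.out.1.2.1, q'.out.1.2.2⟩ * u} : ℚ))⁻¹) (f q) := by
    intro q
    induction q using Quot.ind with
    | _ x =>
      show ((Nat.card {u : ℍ[ℚ,((-1 : ℤ) : ℚ),((3 : ℤ) : ℚ)] // (u ∈ order (-1) 3 ∨ u - ⟨1/2, 1/2, 1/2, -1/2⟩ ∈ order (-1) 3) ∧ ((u * star u).re = 1 ∨ (u * star u).re = -1) ∧ u * (⟨0, ((Quot.mk R x).out).1.1, ((Quot.mk R x).out).1.2.1, ((Quot.mk R x).out).1.2.2⟩ : ℍ[ℚ,((-1 : ℤ) : ℚ),((3 : ℤ) : ℚ)]) = (⟨0, ((Quot.mk R x).out).1.1, ((Quot.mk R x).out).1.2.1, ((Quot.mk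 R x).out).1.2.2⟩ : ℍ[ℚ,((-1 : ℤ) : ℚ),((3 : ℤ) : ℚ)]) * u} : ℚ))⁻¹ =
        ((Nat.card {u : ℍ[ℚ,((-1 : ℤ) : ℚ),((3 : ℤ) : ℚ)] // (u ∈ order (-1) 3 ∨ u - ⟨1/2, 1/2, 1/2, -1/2⟩ ∈ order (-1) 3) ∧ ((u * star u).re = 1 ∨ (u * star u).re = -1) ∧ u * (⟨0, ((Quot.mk R' x).out).1.1, ((Quot.mk R' x).out).1.2.1, ((Quot.mk R' x).out).1.2.2⟩ : ℍ[ℚ,((-1 : ℤ) : ℚ),((3 : ℤ) : ℚ)]) = (⟨0, ((Quot.mk R' x).out).1.1, ((Quot.mk R' x).out).1.2.1, ((Quot.mk R' x).out).1.2.2⟩ : ℍ[ℚ,((-1 : ℤ) : ℚ),((3 : ℤ) : ℚ)]) * u} : ℚ))⁻¹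
      rw [hout, hout']
  have hπ : ∀ q : Quot R, Quot.map pa cpa q ≠ q := by
    -- `[x^e] ≠ [x]`
    intro q
    induction q using Quot.ind with
    | _ x =>
      show Quot.mk R (pa x) ≠ Quot.mk R x
      rw [Ne, hiff]
      intro h
      have h' := hE.symm h
      simp only [hR, hpa] at h'
      obtain ⟨u, hu, hn, h⟩ := h'
      have q4 := e_quadruple_pairwise_not_normOne_conj ![x.1.1, x.1.2.1, x.1.2.2] (by simpa using hQ x) hn
      simp only [Matrix.cons_val_zero, Matrix.cons_val_one, Matrix.cons_val_two, Matrix.head_cons, Matrix.tail_cons]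
        at q4
      exact q4.1 h
  have hf : Function.Surjective f := by
    intro q
    induction q using Quot.ind with
    | _ x => exact ⟨Quot.mk R x, rfl⟩
  have hfπ : ∀ q : Quot R, f (Quot.map pa cpa q) = f q := by
    -- `x^e` is `O₆^×`-conjugate to `x` (by `ē`)
    intro q
    induction q using Quot.ind with
    | _ x =>
      show Quot.mk R' (pa x) = Quot.mk R' x
      rw [hiff']
      simp only [hR', hpa]
      exact ⟨_, star_e_conj_partner x.1.1 x.1.2.1 x.1.2.2⟩
  have hff : ∀ q₁ q₂ : Quot R, f q₁ = f q₂ → q₁ = q₂ ∨ q₁ = Quot.map pa cpa q₂ := by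
    -- fibres are `{[x], [x^e]}`
    intro q₁ q₂
    induction q₁ using Quot.ind with
    | _ x₁ =>
      induction q₂ using Quot.ind with
      | _ x₂ =>
        intro h
        change Quot.mk R' x₁ = Quot.mk R' x₂ at h
        rw [hiff'] at h
        rcases hsplit x₁ x₂ h with h | h
        · exact Or.inl ((hiff _ _).2 h)
        · right
          have h1 : Quot.mk R (pa x₁) = Quot.mk R x₂ := (hiff _ _).2 h
          have h2 := hππ (Quot.mk R x₁)
          change Quot.mk R (pa (pa x₁)) = Quot.mk R x₁ at h2
          rw [← h2]
          show Quot.mk R (pa (pa x₁)) = Quot.mk R (pa x₂)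
          exact congrArg (Quot.map pa cpa) h1
  -- (elaborated without expected type: the weighted two-sheets count, then the termwise identification)
  have key := finsum_comp_eq_two_mul_finsum₃₉ (Quot.map pa cpa) hπ f hf hfπ hff (fun q' : Quot R' ↦ ((Nat.card
          {u : ℍ[ℚ,((-1 : ℤ) : ℚ),((3 : ℤ) : ℚ)] // (u ∈ order (-1) 3 ∨ u - ⟨1/2, 1/2, 1/2, -1/2⟩ ∈ order (-1) 3) ∧
            ((u * star u).re = 1 ∨ (u * star u).re = -1) ∧
            u * ⟨0, q'.out.1.1, q'.out.1.2.1, q'.out.1.2.2⟩ = ⟨0, q'.out.1.1, q'.out.1.2.1, q'.out.1.2.2⟩ * u} : ℚ))⁻¹)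
  have key' := (finsum_congr hcongr).trans key
  exact key'

/-- **`Σᶠ_{[x] ∈ L(t)/O₆^×} e_x⁻¹ = 2·Σᶠ_{{±x} ∈ L(t)/±O₆^×} e_x⁻¹` FOR EVERY `t > 0`** — the sign involution `x ↦ −x` on
Kudla–Rapoport–Yang's index set is free (Lemma 3.4.3 (i) «`−x ∉ Γ·x`») and `e_{−x} = e_x`: «the vectors `x` and `−x` both
contribute the same pair of points to the sum» (3.4.13), with the same multiplicity, so `deg Z(t)_ℚ = 4·Σ_{±x} e_x⁻¹`.
[cite: KudlaRapoportYang2006, §3.4 Lemma 3.4.3 (i), (3.4.13)–(3.4.14) and p. 54] -/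
theorem finsum_unit_classes_eq_two_mul_finsum_unitSign_classes {t : ℤ} (ht : 0 < t) :
    ∑ᶠ q : (Quot (fun x y : {x : ℤ × ℤ × ℤ // x.1 ^ 2 - 3 * x.2.1 ^ 2 - 3 * x.2.2 ^ 2 = t} ↦
      ∃ v : ℍ[ℚ,((-1 : ℤ) : ℚ),((3 : ℤ) : ℚ)], (v ∈ order (-1) 3 ∨ v - ⟨1/2, 1/2, 1/2, -1/2⟩ ∈ order (-1) 3) ∧
        ((v * star v).re = 1 ∨ (v * star v).re = -1) ∧
        v * ⟨0, x.1.1, x.1.2.1, x.1.2.2⟩ = ⟨0, y.1.1, y.1.2.1, y.1.2.2⟩ * v)),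
        ((Nat.card
          {u : ℍ[ℚ,((-1 : ℤ) : ℚ),((3 : ℤ) : ℚ)] // (u ∈ order (-1) 3 ∨ u - ⟨1/2, 1/2, 1/2, -1/2⟩ ∈ order (-1) 3) ∧
            ((u * star u).re = 1 ∨ (u * star u).re = -1) ∧
            u * ⟨0, q.out.1.1, q.out.1.2.1, q.out.1.2.2⟩ = ⟨0, q.out.1.1, q.out.1.2.1, q.out.1.2.2⟩ * u} : ℚ))⁻¹ =
    2 * ∑ᶠ q : (Quot (fun x y : {x : ℤ × ℤ × ℤ // x.1 ^ 2 - 3 * x.2.1 ^ 2 - 3 * x.2.2 ^ 2 = t} ↦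
      ∃ v : ℍ[ℚ,((-1 : ℤ) : ℚ),((3 : ℤ) : ℚ)], (v ∈ order (-1) 3 ∨ v - ⟨1/2, 1/2, 1/2, -1/2⟩ ∈ order (-1) 3) ∧
        ((v * star v).re = 1 ∨ (v * star v).re = -1) ∧
        (v * ⟨0, x.1.1, x.1.2.1, x.1.2.2⟩ = ⟨0, y.1.1, y.1.2.1, y.1.2.2⟩ * v ∨
          v * ⟨0, x.1.1, x.1.2.1, x.1.2.2⟩ = -(⟨0, y.1.1, y.1.2.1, y.1.2.2⟩ * v)))),
        ((Nat.card
          {u : ℍ[ℚ,((-1 : ℤ) : ℚ),((3 : ℤ) : ℚ)] // (u ∈ order (-1) 3 ∨ u - ⟨1/2, 1/2, 1/2, -1/2⟩ ∈ order (-1) 3) ∧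
            ((u * star u).re = 1 ∨ (u * star u).re = -1) ∧
            u * ⟨0, q.out.1.1, q.out.1.2.1, q.out.1.2.2⟩ = ⟨0, q.out.1.1, q.out.1.2.1, q.out.1.2.2⟩ * u} : ℚ))⁻¹ := by
  have hfin' := finite_unit_classes ht
  set R : {x : ℤ × ℤ × ℤ // x.1 ^ 2 - 3 * x.2.1 ^ 2 - 3 * x.2.2 ^ 2 = t} → {x : ℤ × ℤ × ℤ // x.1 ^ 2 - 3 * x.2.1 ^ 2 - 3 * x.2.2 ^ 2 = t} → Prop := (fun x y : {x : ℤ × ℤ × ℤ // x.1 ^ 2 - 3 * x.2.1 ^ 2 - 3 * x.2.2 ^ 2 = t} ↦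
      ∃ u : ℍ[ℚ,((-1 : ℤ) : ℚ),((3 : ℤ) : ℚ)], (u ∈ order (-1) 3 ∨ u - ⟨1/2, 1/2, 1/2, -1/2⟩ ∈ order (-1) 3) ∧
        (u * star u).re = 1 ∧ u * ⟨0, x.1.1, x.1.2.1, x.1.2.2⟩ = ⟨0, y.1.1, y.1.2.1, y.1.2.2⟩ * u) with hR
  set R' : {x : ℤ × ℤ × ℤ // x.1 ^ 2 - 3 * x.2.1 ^ 2 - 3 * x.2.2 ^ 2 = t} → {x : ℤ × ℤ × ℤ // x.1 ^ 2 - 3 * x.2.1 ^ 2 - 3 * x.2.2 ^ 2 = t} → Prop := (fun x y : {x : ℤ × ℤ × ℤ // x.1 ^ 2 - 3 * x.2.1 ^ 2 - 3 * x.2.2 ^ 2 = t} ↦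
      ∃ v : ℍ[ℚ,((-1 : ℤ) : ℚ),((3 : ℤ) : ℚ)], (v ∈ order (-1) 3 ∨ v - ⟨1/2, 1/2, 1/2, -1/2⟩ ∈ order (-1) 3) ∧
        ((v * star v).re = 1 ∨ (v * star v).re = -1) ∧
        v * ⟨0, x.1.1, x.1.2.1, x.1.2.2⟩ = ⟨0, y.1.1, y.1.2.1, y.1.2.2⟩ * v) with hR'
  set S : {x : ℤ × ℤ × ℤ // x.1 ^ 2 - 3 * x.2.1 ^ 2 - 3 * x.2.2 ^ 2 = t} → {x : ℤ × ℤ × ℤ // x.1 ^ 2 - 3 * x.2.1 ^ 2 - 3 * x.2.2 ^ 2 = t} → Prop := (fun x y : {x : ℤ × ℤ × ℤ // x.1 ^ 2 - 3 * x.2.1 ^ 2 - 3 * x.2.2 ^ 2 = t} ↦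
      ∃ v : ℍ[ℚ,((-1 : ℤ) : ℚ),((3 : ℤ) : ℚ)], (v ∈ order (-1) 3 ∨ v - ⟨1/2, 1/2, 1/2, -1/2⟩ ∈ order (-1) 3) ∧
        ((v * star v).re = 1 ∨ (v * star v).re = -1) ∧
        (v * ⟨0, x.1.1, x.1.2.1, x.1.2.2⟩ = ⟨0, y.1.1, y.1.2.1, y.1.2.2⟩ * v ∨
          v * ⟨0, x.1.1, x.1.2.1, x.1.2.2⟩ = -(⟨0, y.1.1, y.1.2.1, y.1.2.2⟩ * v))) with hS
  haveI : Finite (Quot R') := hfin'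
  have hE : Equivalence R := normOne_conj_equivalence t
  have hE' : Equivalence R' := unit_conj_equivalence t
  have hiff' : ∀ x y, Quot.mk R' x = Quot.mk R' y ↔ R' x y := unit_conj_mk_eq_iff t
  have hiffS : ∀ x y, Quot.mk S x = Quot.mk S y ↔ S x y := unitSign_conj_mk_eq_iff t
  have hsub : ∀ x y, R' x y → S x y := by
    rintro x y ⟨v, hv, hn, h⟩
    simp only [hS]
    exact ⟨v, hv, hn, Or.inl h⟩
  -- the sign map on vectors
  set ng : {x : ℤ × ℤ × ℤ // x.1 ^ 2 - 3 * x.2.1 ^ 2 - 3 * x.2.2 ^ 2 = t} → {x : ℤ × ℤ × ℤ // x.1 ^ 2 - 3 * x.2.1 ^ 2 - 3 * x.2.2 ^ 2 = t} :=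
    fun x ↦ ⟨(-x.1.1, -x.1.2.1, -x.1.2.2), by
      show (-x.1.1) ^ 2 - 3 * (-x.1.2.1) ^ 2 - 3 * (-x.1.2.2) ^ 2 = t; linear_combination x.2⟩ with hng
  set pa : {x : ℤ × ℤ × ℤ // x.1 ^ 2 - 3 * x.2.1 ^ 2 - 3 * x.2.2 ^ 2 = t} → {x : ℤ × ℤ × ℤ // x.1 ^ 2 - 3 * x.2.1 ^ 2 - 3 * x.2.2 ^ 2 = t} :=
    fun x ↦ ⟨(-2 * x.1.1 + 3 * x.1.2.1, -x.1.2.2, x.1.1 - 2 * x.1.2.1), by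
      show (-2 * x.1.1 + 3 * x.1.2.1) ^ 2 - 3 * (-x.1.2.2) ^ 2 - 3 * (x.1.1 - 2 * x.1.2.1) ^ 2 = t
      linear_combination x.2⟩ with hpa
  have cng : ∀ x y, R' x y → R' (ng x) (ng y) := by
    rintro x y ⟨v, hv, hn, h⟩
    simp only [hR', hng]
    refine ⟨v, hv, hn, ?_⟩
    rw [neg_pureVec₃₉, neg_pureVec₃₉, mul_neg, neg_mul, h]
  have hQ : ∀ x : {x : ℤ × ℤ × ℤ // x.1 ^ 2 - 3 * x.2.1 ^ 2 - 3 * x.2.2 ^ 2 = t}, 0 < x.1.1 ^ 2 - 3 * x.1.2.1 ^ 2 - 3 * x.1.2.2 ^ 2 := fun x ↦ by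
    have hx : x.1.1 ^ 2 - 3 * x.1.2.1 ^ 2 - 3 * x.1.2.2 ^ 2 = t := x.2
    rw [hx]; exact ht
  have hsplit : ∀ x y : {x : ℤ × ℤ × ℤ // x.1 ^ 2 - 3 * x.2.1 ^ 2 - 3 * x.2.2 ^ 2 = t}, R' x y → R x y ∨ R (pa x) y := by
    intro x y h
    have key := (unit_conj_iff_normOne_conj_or_e_partner ![x.1.1, x.1.2.1, x.1.2.2] (⟨0, y.1.1, y.1.2.1, y.1.2.2⟩ : ℍ[ℚ,((-1 : ℤ) : ℚ),((3 : ℤ) : ℚ)])).1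
    simp only [Matrix.cons_val_zero, Matrix.cons_val_one, Matrix.cons_val_two, Matrix.head_cons, Matrix.tail_cons]
      at key
    simp only [hR'] at h
    simp only [hR, hpa]
    exact key h
  -- `e` at representatives
  have hout' : ∀ x : {x : ℤ × ℤ × ℤ // x.1 ^ 2 - 3 * x.2.1 ^ 2 - 3 * x.2.2 ^ 2 = t}, Nat.card {u : ℍ[ℚ,((-1 : ℤ) : ℚ),((3 : ℤ) : ℚ)] // (u ∈ order (-1) 3 ∨ u - ⟨1/2, 1/2, 1/2, -1/2⟩ ∈ order (-1) 3) ∧ ((u * star u).re = 1 ∨ (u * star u).re = -1) ∧ u * (⟨0, ((Quot.mk R' x).out).1.1, ((Quot.mk R' x).out).1.2.1, ((Quot.mk R' x).out).1.2.2⟩ : ℍ[ℚ,((-1 : ℤ) : ℚ),((3 : ℤ) : ℚ)]) = (⟨0, ((Quot.mk R' x).out).1.1, ((Quot.mk R' x).out).1.2.1, ((Quot.mk R' x).out).1.2.2⟩ : ℍ[ℚ,((-1 : ℤ) : ℚ),((3 : ℤ) : ℚ)]) * u} =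
      Nat.card {u : ℍ[ℚ,((-1 : ℤ) : ℚ),((3 : ℤ) : ℚ)] // (u ∈ order (-1) 3 ∨ u - ⟨1/2, 1/2, 1/2, -1/2⟩ ∈ order (-1) 3) ∧ ((u * star u).re = 1 ∨ (u * star u).re = -1) ∧ u * (⟨0, x.1.1, x.1.2.1, x.1.2.2⟩ : ℍ[ℚ,((-1 : ℤ) : ℚ),((3 : ℤ) : ℚ)]) = (⟨0, x.1.1, x.1.2.1, x.1.2.2⟩ : ℍ[ℚ,((-1 : ℤ) : ℚ),((3 : ℤ) : ℚ)]) * u} := card_unitStab_mk_out t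
  have houtS : ∀ x : {x : ℤ × ℤ × ℤ // x.1 ^ 2 - 3 * x.2.1 ^ 2 - 3 * x.2.2 ^ 2 = t}, Nat.card {u : ℍ[ℚ,((-1 : ℤ) : ℚ),((3 : ℤ) : ℚ)] // (u ∈ order (-1) 3 ∨ u - ⟨1/2, 1/2, 1/2, -1/2⟩ ∈ order (-1) 3) ∧ ((u * star u).re = 1 ∨ (u * star u).re = -1) ∧ u * (⟨0, ((Quot.mk S x).out).1.1, ((Quot.mk S x).out).1.2.1, ((Quot.mk S x).out).1.2.2⟩ : ℍ[ℚ,((-1 : ℤ) : ℚ),((3 : ℤ) : ℚ)]) = (⟨0, ((Quot.mk S x).out).1.1, ((Quot.mk S x).out).1.2.1, ((Quot.mk S x).out).1.2.2⟩ : ℍ[ℚ,((-1 : ℤ) : ℚ),((3 : ℤ) : ℚ)]) * u} =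
      Nat.card {u : ℍ[ℚ,((-1 : ℤ) : ℚ),((3 : ℤ) : ℚ)] // (u ∈ order (-1) 3 ∨ u - ⟨1/2, 1/2, 1/2, -1/2⟩ ∈ order (-1) 3) ∧ ((u * star u).re = 1 ∨ (u * star u).re = -1) ∧ u * (⟨0, x.1.1, x.1.2.1, x.1.2.2⟩ : ℍ[ℚ,((-1 : ℤ) : ℚ),((3 : ℤ) : ℚ)]) = (⟨0, x.1.1, x.1.2.1, x.1.2.2⟩ : ℍ[ℚ,((-1 : ℤ) : ℚ),((3 : ℤ) : ℚ)]) * u} := card_unitStab_unitSign_mk_out t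
  -- the comparison map `L(t)/O₆^× → L(t)/±O₆^×` and the weight
  let f : Quot R' → Quot S := Quot.lift (Quot.mk S) fun x y h ↦ Quot.sound (hsub x y h)
  have hcongr : ∀ q : Quot R', ((Nat.card
          {u : ℍ[ℚ,((-1 : ℤ) : ℚ),((3 : ℤ) : ℚ)] // (u ∈ order (-1) 3 ∨ u - ⟨1/2, 1/2, 1/2, -1/2⟩ ∈ order (-1) 3) ∧
            ((u * star u).re = 1 ∨ (u * star u).re = -1) ∧
            u * ⟨0, q.out.1.1, q.out.1.2.1, q.out.1.2.2⟩ = ⟨0, q.out.1.1, q.out.1.2.1, q.out.1.2.2⟩ * u} : ℚ))⁻¹ =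
      (fun q' : Quot S ↦ ((Nat.card
          {u : ℍ[ℚ,((-1 : ℤ) : ℚ),((3 : ℤ) : ℚ)] // (u ∈ order (-1) 3 ∨ u - ⟨1/2, 1/2, 1/2, -1/2⟩ ∈ order (-1) 3) ∧
            ((u * star u).re = 1 ∨ (u * star u).re = -1) ∧
            u * ⟨0, q'.out.1.1, q'.out.1.2.1, q'.out.1.2.2⟩ = ⟨0, q'.out.1.1, q'.out.1.2.1, q'.out.1.2.2⟩ * u} : ℚ))⁻¹) (f q) := by
    intro q
    induction q using Quot.ind with
    | _ x =>
      show ((Nat.card {u : ℍ[ℚ,((-1 : ℤ) : ℚ),((3 : ℤ) : ℚ)] // (u ∈ order (-1) 3 ∨ u - ⟨1/2, 1/2, 1/2, -1/2⟩ ∈ order (-1) 3) ∧ ((u * star u).re = 1 ∨ (u * star u).re = -1) ∧ u * (⟨0, ((Quot.mk R' x).out).1.1, ((Quot.mk R' x).out).1.2.1, ((Quot.mk R' x).out).1.2.2⟩ : ℍ[ℚ,((-1 : ℤ) : ℚ),((3 : ℤ) : ℚ)]) = (⟨0, ((Quot.mk R' x).out).1.1, ((Quot.mk R' x).out).1.2.1,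 ((Quot.mk R' x).out).1.2.2⟩ : ℍ[ℚ,((-1 : ℤ) : ℚ),((3 : ℤ) : ℚ)]) * u} : ℚ))⁻¹ =
        ((Nat.card {u : ℍ[ℚ,((-1 : ℤ) : ℚ),((3 : ℤ) : ℚ)] // (u ∈ order (-1) 3 ∨ u - ⟨1/2, 1/2, 1/2, -1/2⟩ ∈ order (-1) 3) ∧ ((u * star u).re = 1 ∨ (u * star u).re = -1) ∧ u * (⟨0, ((Quot.mk S x).out).1.1, ((Quot.mk S x).out).1.2.1, ((Quot.mk S x).out).1.2.2⟩ : ℍ[ℚ,((-1 : ℤ) : ℚ),((3 : ℤ) : ℚ)]) = (⟨0, ((Quot.mk S x).out).1.1, ((Quot.mk S x).out).1.2.1, ((Quot.mk S x).out).1.2.2⟩ : ℍ[ℚ,((-1 : ℤ) : ℚ),((3 : ℤ) : ℚ)]) * u} : ℚ))⁻¹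
      rw [hout', houtS]
  have hπ : ∀ q : Quot R', Quot.map ng cng q ≠ q := by
    -- `[−x] ≠ [x]` modulo `O₆^×`
    intro q
    induction q using Quot.ind with
    | _ x =>
      show Quot.mk R' (ng x) ≠ Quot.mk R' x
      rw [Ne, hiff']
      intro h
      rcases hsplit x (ng x) (hE'.symm h) with h' | h'
      · simp only [hR, hng] at h'
        obtain ⟨u, hu, hn, h'⟩ := h'
        rw [neg_pureVec₃₉] at h'
        have q4 := e_quadruple_pairwise_not_normOne_conj ![x.1.1, x.1.2.1, x.1.2.2] (by simpa using hQ x) hn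
        simp only [Matrix.cons_val_zero, Matrix.cons_val_one, Matrix.cons_val_two, Matrix.head_cons,
          Matrix.tail_cons] at q4
        exact q4.2.2.1 h'
      · have h'' := hE.symm h'
        simp only [hR, hng, hpa] at h''
        obtain ⟨u, hu, hn, h''⟩ := h''
        rw [neg_pureVec₃₉] at h''
        have q4 := e_quadruple_pairwise_not_normOne_conj ![x.1.1, x.1.2.1, x.1.2.2] (by simpa using hQ x) hn
        simp only [Matrix.cons_val_zero, Matrix.cons_val_one, Matrix.cons_val_two, Matrix.head_cons,
          Matrix.tail_cons] at q4
        exact q4.2.2.2.2.2 h''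
  have hf : Function.Surjective f := by
    intro q
    induction q using Quot.ind with
    | _ x => exact ⟨Quot.mk R' x, rfl⟩
  have hfπ : ∀ q : Quot R', f (Quot.map ng cng q) = f q := by
    -- `−x ≈ x` up to sign
    intro q
    induction q using Quot.ind with
    | _ x =>
      show Quot.mk S (ng x) = Quot.mk S x
      rw [hiffS]
      simp only [hS, hng]
      refine ⟨1, Or.inl (Subring.one_mem _), Or.inl (by rw [star_one, mul_one, QuaternionAlgebra.re_one]), Or.inr ?_⟩
      rw [neg_pureVec₃₉, one_mul, mul_one]
  have hff : ∀ q₁ q₂ : Quot R', f q₁ = f q₂ → q₁ = q₂ ∨ q₁ = Quot.map ng cng q₂ := by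
    -- fibres `{[x], [−x]}`
    intro q₁ q₂
    induction q₁ using Quot.ind with
    | _ x₁ =>
      induction q₂ using Quot.ind with
      | _ x₂ =>
        intro h
        change Quot.mk S x₁ = Quot.mk S x₂ at h
        rw [hiffS] at h
        simp only [hS] at h
        obtain ⟨v, hv, hn, h | h⟩ := h
        · exact Or.inl ((hiff' _ _).2 (by simp only [hR']; exact ⟨v, hv, hn, h⟩))
        · right
          show Quot.mk R' x₁ = Quot.mk R' (ng x₂)
          rw [hiff']
          simp only [hR', hng]
          refine ⟨v, hv, hn, ?_⟩
          rw [neg_pureVec₃₉, neg_mul, h]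
  have key := finsum_comp_eq_two_mul_finsum₃₉ (Quot.map ng cng) hπ f hf hfπ hff (fun q' : Quot S ↦ ((Nat.card
          {u : ℍ[ℚ,((-1 : ℤ) : ℚ),((3 : ℤ) : ℚ)] // (u ∈ order (-1) 3 ∨ u - ⟨1/2, 1/2, 1/2, -1/2⟩ ∈ order (-1) 3) ∧
            ((u * star u).re = 1 ∨ (u * star u).re = -1) ∧
            u * ⟨0, q'.out.1.1, q'.out.1.2.1, q'.out.1.2.2⟩ = ⟨0, q'.out.1.1, q'.out.1.2.1, q'.out.1.2.2⟩ * u} : ℚ))⁻¹)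
  have key' := (finsum_congr hcongr).trans key
  exact key'

/-- **`Σᶠ_{L(t)/Γ₆} e⁻¹ = 4·Σᶠ_{L(t)/±O₆^×} e⁻¹`** (`t > 0`): the classes modulo the Fuchsian group against the sign pairs of
KRY's index set — `|L(t)/Γ₆| = 4·#{sign pairs}` of `…XSixSpecialCyclesClassCount`, weighted. [cite: KudlaRapoportYang2006, §3.4 Lemma 3.4.3 (i), (3.4.13)–(3.4.14)] [cite: VignerasLNM800, Ch. III §5.C Cor. 5.13] -/
theorem finsum_normOne_classes_eq_four_mul_finsum_unitSign_classes {t : ℤ} (ht : 0 < t) :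
    ∑ᶠ q : (Quot (fun x y : {x : ℤ × ℤ × ℤ // x.1 ^ 2 - 3 * x.2.1 ^ 2 - 3 * x.2.2 ^ 2 = t} ↦
      ∃ u : ℍ[ℚ,((-1 : ℤ) : ℚ),((3 : ℤ) : ℚ)], (u ∈ order (-1) 3 ∨ u - ⟨1/2, 1/2, 1/2, -1/2⟩ ∈ order (-1) 3) ∧
        (u * star u).re = 1 ∧ u * ⟨0, x.1.1, x.1.2.1, x.1.2.2⟩ = ⟨0, y.1.1, y.1.2.1, y.1.2.2⟩ * u)),
        ((Nat.card
          {u : ℍ[ℚ,((-1 : ℤ) : ℚ),((3 : ℤ) : ℚ)] // (u ∈ order (-1) 3 ∨ u - ⟨1/2, 1/2, 1/2, -1/2⟩ ∈ order (-1) 3) ∧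
            ((u * star u).re = 1 ∨ (u * star u).re = -1) ∧
            u * ⟨0, q.out.1.1, q.out.1.2.1, q.out.1.2.2⟩ = ⟨0, q.out.1.1, q.out.1.2.1, q.out.1.2.2⟩ * u} : ℚ))⁻¹ =
    4 * ∑ᶠ q : (Quot (fun x y : {x : ℤ × ℤ × ℤ // x.1 ^ 2 - 3 * x.2.1 ^ 2 - 3 * x.2.2 ^ 2 = t} ↦
      ∃ v : ℍ[ℚ,((-1 : ℤ) : ℚ),((3 : ℤ) : ℚ)], (v ∈ order (-1) 3 ∨ v - ⟨1/2, 1/2, 1/2, -1/2⟩ ∈ order (-1) 3) ∧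
        ((v * star v).re = 1 ∨ (v * star v).re = -1) ∧
        (v * ⟨0, x.1.1, x.1.2.1, x.1.2.2⟩ = ⟨0, y.1.1, y.1.2.1, y.1.2.2⟩ * v ∨
          v * ⟨0, x.1.1, x.1.2.1, x.1.2.2⟩ = -(⟨0, y.1.1, y.1.2.1, y.1.2.2⟩ * v)))),
        ((Nat.card
          {u : ℍ[ℚ,((-1 : ℤ) : ℚ),((3 : ℤ) : ℚ)] // (u ∈ order (-1) 3 ∨ u - ⟨1/2, 1/2, 1/2, -1/2⟩ ∈ order (-1) 3) ∧
            ((u * star u).re = 1 ∨ (u * star u).re = -1) ∧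
            u * ⟨0, q.out.1.1, q.out.1.2.1, q.out.1.2.2⟩ = ⟨0, q.out.1.1, q.out.1.2.1, q.out.1.2.2⟩ * u} : ℚ))⁻¹ := by
  rw [finsum_normOne_classes_eq_two_mul_finsum_unit_classes ht, finsum_unit_classes_eq_two_mul_finsum_unitSign_classes ht]
  ring

end IndexSets

/-! ## §3 The ramified primes: `Σᶠ_{L(4t)/O₆^×} e⁻¹ = Σᶠ_{L(9t)/O₆^×} e⁻¹ = Σᶠ_{L(t)/O₆^×} e⁻¹` -/

section Scaling

/-- **The scaling engine**: a descent `L(kt) = c·L(t)` (`c ≠ 0`) gives a bijection `[ŷ] ↦ [c·ŷ]` of `O₆^×`-classes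
(`conj_ratSmul_iff`) along which `e` is constant (`card_unitStab_smul`), so the weighted sums agree. [folklore] -/
private theorem finsum_scale_engine₃₉ {t k : ℤ} (c : ℤ) (hc : c ≠ 0)
    (hdesc : ∀ x : ℤ × ℤ × ℤ, x.1 ^ 2 - 3 * x.2.1 ^ 2 - 3 * x.2.2 ^ 2 = k * t ↔
      ∃ y : ℤ × ℤ × ℤ, x = (c * y.1, c * y.2.1, c * y.2.2) ∧ y.1 ^ 2 - 3 * y.2.1 ^ 2 - 3 * y.2.2 ^ 2 = t) :
    ∑ᶠ q : (Quot (fun x y : {x : ℤ × ℤ × ℤ // x.1 ^ 2 - 3 * x.2.1 ^ 2 - 3 * x.2.2 ^ 2 = k * t} ↦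
      ∃ v : ℍ[ℚ,((-1 : ℤ) : ℚ),((3 : ℤ) : ℚ)], (v ∈ order (-1) 3 ∨ v - ⟨1/2, 1/2, 1/2, -1/2⟩ ∈ order (-1) 3) ∧
        ((v * star v).re = 1 ∨ (v * star v).re = -1) ∧
        v * ⟨0, x.1.1, x.1.2.1, x.1.2.2⟩ = ⟨0, y.1.1, y.1.2.1, y.1.2.2⟩ * v)),
        ((Nat.card
          {u : ℍ[ℚ,((-1 : ℤ) : ℚ),((3 : ℤ) : ℚ)] // (u ∈ order (-1) 3 ∨ u - ⟨1/2, 1/2, 1/2, -1/2⟩ ∈ order (-1) 3) ∧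
            ((u * star u).re = 1 ∨ (u * star u).re = -1) ∧
            u * ⟨0, q.out.1.1, q.out.1.2.1, q.out.1.2.2⟩ = ⟨0, q.out.1.1, q.out.1.2.1, q.out.1.2.2⟩ * u} : ℚ))⁻¹ =
    ∑ᶠ q : (Quot (fun x y : {x : ℤ × ℤ × ℤ // x.1 ^ 2 - 3 * x.2.1 ^ 2 - 3 * x.2.2 ^ 2 = t} ↦
      ∃ v : ℍ[ℚ,((-1 : ℤ) : ℚ),((3 : ℤ) : ℚ)], (v ∈ order (-1) 3 ∨ v - ⟨1/2, 1/2, 1/2, -1/2⟩ ∈ order (-1) 3) ∧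
        ((v * star v).re = 1 ∨ (v * star v).re = -1) ∧
        v * ⟨0, x.1.1, x.1.2.1, x.1.2.2⟩ = ⟨0, y.1.1, y.1.2.1, y.1.2.2⟩ * v)),
        ((Nat.card
          {u : ℍ[ℚ,((-1 : ℤ) : ℚ),((3 : ℤ) : ℚ)] // (u ∈ order (-1) 3 ∨ u - ⟨1/2, 1/2, 1/2, -1/2⟩ ∈ order (-1) 3) ∧
            ((u * star u).re = 1 ∨ (u * star u).re = -1) ∧
            u * ⟨0, q.out.1.1, q.out.1.2.1, q.out.1.2.2⟩ = ⟨0, q.out.1.1, q.out.1.2.1, q.out.1.2.2⟩ * u} : ℚ))⁻¹ := by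
  have hc' : (c : ℚ) ≠ 0 := by exact_mod_cast hc
  set Rk : {x : ℤ × ℤ × ℤ // x.1 ^ 2 - 3 * x.2.1 ^ 2 - 3 * x.2.2 ^ 2 = k * t} → {x : ℤ × ℤ × ℤ // x.1 ^ 2 - 3 * x.2.1 ^ 2 - 3 * x.2.2 ^ 2 = k * t} → Prop := (fun x y : {x : ℤ × ℤ × ℤ // x.1 ^ 2 - 3 * x.2.1 ^ 2 - 3 * x.2.2 ^ 2 = k * t} ↦
      ∃ v : ℍ[ℚ,((-1 : ℤ) : ℚ),((3 : ℤ) : ℚ)], (v ∈ order (-1) 3 ∨ v - ⟨1/2, 1/2, 1/2, -1/2⟩ ∈ order (-1) 3) ∧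
        ((v * star v).re = 1 ∨ (v * star v).re = -1) ∧
        v * ⟨0, x.1.1, x.1.2.1, x.1.2.2⟩ = ⟨0, y.1.1, y.1.2.1, y.1.2.2⟩ * v) with hRk
  set R : {x : ℤ × ℤ × ℤ // x.1 ^ 2 - 3 * x.2.1 ^ 2 - 3 * x.2.2 ^ 2 = t} → {x : ℤ × ℤ × ℤ // x.1 ^ 2 - 3 * x.2.1 ^ 2 - 3 * x.2.2 ^ 2 = t} → Prop := (fun x y : {x : ℤ × ℤ × ℤ // x.1 ^ 2 - 3 * x.2.1 ^ 2 - 3 * x.2.2 ^ 2 = t} ↦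
      ∃ v : ℍ[ℚ,((-1 : ℤ) : ℚ),((3 : ℤ) : ℚ)], (v ∈ order (-1) 3 ∨ v - ⟨1/2, 1/2, 1/2, -1/2⟩ ∈ order (-1) 3) ∧
        ((v * star v).re = 1 ∨ (v * star v).re = -1) ∧
        v * ⟨0, x.1.1, x.1.2.1, x.1.2.2⟩ = ⟨0, y.1.1, y.1.2.1, y.1.2.2⟩ * v) with hR
  have hiff : ∀ x y, Quot.mk Rk x = Quot.mk Rk y ↔ Rk x y := unit_conj_mk_eq_iff (k * t)
  -- the scaling map `y ↦ c·y`
  set sc : {x : ℤ × ℤ × ℤ // x.1 ^ 2 - 3 * x.2.1 ^ 2 - 3 * x.2.2 ^ 2 = t} → {x : ℤ × ℤ × ℤ // x.1 ^ 2 - 3 * x.2.1 ^ 2 - 3 * x.2.2 ^ 2 = k * t} := fun y ↦ ⟨(c * y.1.1, c * y.1.2.1, c * y.1.2.2), (hdesc _).2 ⟨y.1, rfl, y.2⟩⟩ with hsc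
  have hsc_vec : ∀ y : {x : ℤ × ℤ × ℤ // x.1 ^ 2 - 3 * x.2.1 ^ 2 - 3 * x.2.2 ^ 2 = t}, (⟨0, (sc y).1.1, (sc y).1.2.1, (sc y).1.2.2⟩ : ℍ[ℚ,((-1 : ℤ) : ℚ),((3 : ℤ) : ℚ)]) = (c : ℚ) • ⟨0, y.1.1, y.1.2.1, y.1.2.2⟩ := fun y ↦ pureVec_intMul₃₉ c _ _ _
  have csc : ∀ y y', R y y' → Rk (sc y) (sc y') := by
    rintro y y' ⟨g, hg, hn, h⟩
    refine ⟨g, hg, hn, ?_⟩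
    rw [hsc_vec, hsc_vec, conj_ratSmul_iff hc']
    exact h
  have hbij : Function.Bijective (Quot.map sc csc) := by
    refine ⟨?_, ?_⟩
    · intro a b
      induction a using Quot.ind with
      | _ y =>
        induction b using Quot.ind with
        | _ y' =>
          intro h
          change Quot.mk Rk (sc y) = Quot.mk Rk (sc y') at h
          rw [hiff] at h
          obtain ⟨g, hg, hn, h⟩ := h
          rw [hsc_vec, hsc_vec, conj_ratSmul_iff hc'] at h
          exact Quot.sound ⟨g, hg, hn, h⟩
    · intro q
      induction q using Quot.ind with
      | _ x =>
        obtain ⟨y, hxy, hy⟩ := (hdesc x.1).1 x.2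
        refine ⟨Quot.mk R ⟨y, hy⟩, ?_⟩
        change Quot.mk Rk (sc ⟨y, hy⟩) = Quot.mk Rk x
        congr 1
        exact Subtype.ext hxy.symm
  have hout : ∀ y : {x : ℤ × ℤ × ℤ // x.1 ^ 2 - 3 * x.2.1 ^ 2 - 3 * x.2.2 ^ 2 = t}, Nat.card {u : ℍ[ℚ,((-1 : ℤ) : ℚ),((3 : ℤ) : ℚ)] // (u ∈ order (-1) 3 ∨ u - ⟨1/2, 1/2, 1/2, -1/2⟩ ∈ order (-1) 3) ∧ ((u * star u).re = 1 ∨ (u * star u).re = -1) ∧ u * (⟨0, ((Quot.mk R y).out).1.1, ((Quot.mk R y).out).1.2.1, ((Quot.mk R y).out).1.2.2⟩ : ℍ[ℚ,((-1 : ℤ) : ℚ),((3 : ℤ) : ℚ)]) = (⟨0, ((Quot.mk R y).out).1.1, ((Quot.mk R y).out).1.2.1, ((Quot.mk R y).out).1.2.2⟩ : ℍ[ℚ,((-1 : ℤ) : ℚ),((3 : ℤ) : ℚ)]) * u} =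
      Nat.card {u : ℍ[ℚ,((-1 : ℤ) : ℚ),((3 : ℤ) : ℚ)] // (u ∈ order (-1) 3 ∨ u - ⟨1/2, 1/2, 1/2, -1/2⟩ ∈ order (-1) 3) ∧ ((u * star u).re = 1 ∨ (u * star u).re = -1) ∧ u * (⟨0, y.1.1, y.1.2.1, y.1.2.2⟩ : ℍ[ℚ,((-1 : ℤ) : ℚ),((3 : ℤ) : ℚ)]) = (⟨0, y.1.1, y.1.2.1, y.1.2.2⟩ : ℍ[ℚ,((-1 : ℤ) : ℚ),((3 : ℤ) : ℚ)]) * u} := card_unitStab_mk_out t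
  have houtk : ∀ x : {x : ℤ × ℤ × ℤ // x.1 ^ 2 - 3 * x.2.1 ^ 2 - 3 * x.2.2 ^ 2 = k * t}, Nat.card {u : ℍ[ℚ,((-1 : ℤ) : ℚ),((3 : ℤ) : ℚ)] // (u ∈ order (-1) 3 ∨ u - ⟨1/2, 1/2, 1/2, -1/2⟩ ∈ order (-1) 3) ∧ ((u * star u).re = 1 ∨ (u * star u).re = -1) ∧ u * (⟨0, ((Quot.mk Rk x).out).1.1, ((Quot.mk Rk x).out).1.2.1, ((Quot.mk Rk x).out).1.2.2⟩ : ℍ[ℚ,((-1 : ℤ) : ℚ),((3 : ℤ) : ℚ)]) = (⟨0, ((Quot.mk Rk x).out).1.1, ((Quot.mk Rk x).out).1.2.1, ((Quot.mk Rk x).out).1.2.2⟩ : ℍ[ℚ,((-1 : ℤ) : ℚ),((3 : ℤ) : ℚ)]) * u} =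
      Nat.card {u : ℍ[ℚ,((-1 : ℤ) : ℚ),((3 : ℤ) : ℚ)] // (u ∈ order (-1) 3 ∨ u - ⟨1/2, 1/2, 1/2, -1/2⟩ ∈ order (-1) 3) ∧ ((u * star u).re = 1 ∨ (u * star u).re = -1) ∧ u * (⟨0, x.1.1, x.1.2.1, x.1.2.2⟩ : ℍ[ℚ,((-1 : ℤ) : ℚ),((3 : ℤ) : ℚ)]) = (⟨0, x.1.1, x.1.2.1, x.1.2.2⟩ : ℍ[ℚ,((-1 : ℤ) : ℚ),((3 : ℤ) : ℚ)]) * u} := card_unitStab_mk_out (k * t)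
  rw [← finsum_comp _ hbij]
  refine finsum_congr fun q ↦ ?_
  induction q using Quot.ind with
  | _ y =>
    show ((Nat.card {u : ℍ[ℚ,((-1 : ℤ) : ℚ),((3 : ℤ) : ℚ)] // (u ∈ order (-1) 3 ∨ u - ⟨1/2, 1/2, 1/2, -1/2⟩ ∈ order (-1) 3) ∧ ((u * star u).re = 1 ∨ (u * star u).re = -1) ∧ u * (⟨0, ((Quot.mk Rk (sc y)).out).1.1, ((Quot.mk Rk (sc y)).out).1.2.1, ((Quot.mk Rk (sc y)).out).1.2.2⟩ : ℍ[ℚ,((-1 : ℤ) : ℚ),((3 : ℤ) : ℚ)]) = (⟨0, ((Quot.mk Rk (sc y)).out).1.1, ((Quot.mk Rk (sc y)).out).1.2.1, ((Quot.mk Rk (sc y)).out).1.2.2⟩ : ℍ[ℚ,((-1 : ℤ) : ℚ),((3 : ℤ) : ℚ)]) * u} : ℚ))⁻¹ =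
      ((Nat.card {u : ℍ[ℚ,((-1 : ℤ) : ℚ),((3 : ℤ) : ℚ)] // (u ∈ order (-1) 3 ∨ u - ⟨1/2, 1/2, 1/2, -1/2⟩ ∈ order (-1) 3) ∧ ((u * star u).re = 1 ∨ (u * star u).re = -1) ∧ u * (⟨0, ((Quot.mk R y).out).1.1, ((Quot.mk R y).out).1.2.1, ((Quot.mk R y).out).1.2.2⟩ : ℍ[ℚ,((-1 : ℤ) : ℚ),((3 : ℤ) : ℚ)]) = (⟨0, ((Quot.mk R y).out).1.1, ((Quot.mk R y).out).1.2.1, ((Quot.mk R y).out).1.2.2⟩ : ℍ[ℚ,((-1 : ℤ) : ℚ),((3 : ℤ) : ℚ)]) * u} : ℚ))⁻¹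
    rw [houtk, hsc_vec, card_unitStab_smul hc', hout]

/-- **`Σᶠ_{L(4t)/O₆^×} e⁻¹ = Σᶠ_{L(t)/O₆^×} e⁻¹` FOR EVERY `t`: `deg Z(4t)_ℚ = deg Z(t)_ℚ` on `X₆`** — the descent
`L(4t) = 2·L(t)` at the ramified prime `2 ∣ D(B)` (no primitive vector has norm divisible by `4`), and `e_{2y} = e_y`. On the
class-number side `4·(4t) = (2n)²d` with the same `d`, and `Σ_{c ∣ 2n, (c,6)=1} = Σ_{c ∣ n, (c,6)=1}`.
[cite: KudlaRapoportYang2006, §3.4 (3.4.4)–(3.4.6) («`(c, D) = 1`»), (3.4.14) and Remark 3.4.7] [cite: VignerasLNM800, Ch. II §3 and Ch. III §5 (at a ramified prime only the maximal order embeds)] -/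
theorem finsum_unit_classes_four_mul_eq (t : ℤ) :
    ∑ᶠ q : (Quot (fun x y : {x : ℤ × ℤ × ℤ // x.1 ^ 2 - 3 * x.2.1 ^ 2 - 3 * x.2.2 ^ 2 = 4 * t} ↦
      ∃ v : ℍ[ℚ,((-1 : ℤ) : ℚ),((3 : ℤ) : ℚ)], (v ∈ order (-1) 3 ∨ v - ⟨1/2, 1/2, 1/2, -1/2⟩ ∈ order (-1) 3) ∧
        ((v * star v).re = 1 ∨ (v * star v).re = -1) ∧
        v * ⟨0, x.1.1, x.1.2.1, x.1.2.2⟩ = ⟨0, y.1.1, y.1.2.1, y.1.2.2⟩ * v)),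
        ((Nat.card
          {u : ℍ[ℚ,((-1 : ℤ) : ℚ),((3 : ℤ) : ℚ)] // (u ∈ order (-1) 3 ∨ u - ⟨1/2, 1/2, 1/2, -1/2⟩ ∈ order (-1) 3) ∧
            ((u * star u).re = 1 ∨ (u * star u).re = -1) ∧
            u * ⟨0, q.out.1.1, q.out.1.2.1, q.out.1.2.2⟩ = ⟨0, q.out.1.1, q.out.1.2.1, q.out.1.2.2⟩ * u} : ℚ))⁻¹ =
    ∑ᶠ q : (Quot (fun x y : {x : ℤ × ℤ × ℤ // x.1 ^ 2 - 3 * x.2.1 ^ 2 - 3 * x.2.2 ^ 2 = t} ↦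
      ∃ v : ℍ[ℚ,((-1 : ℤ) : ℚ),((3 : ℤ) : ℚ)], (v ∈ order (-1) 3 ∨ v - ⟨1/2, 1/2, 1/2, -1/2⟩ ∈ order (-1) 3) ∧
        ((v * star v).re = 1 ∨ (v * star v).re = -1) ∧
        v * ⟨0, x.1.1, x.1.2.1, x.1.2.2⟩ = ⟨0, y.1.1, y.1.2.1, y.1.2.2⟩ * v)),
        ((Nat.card
          {u : ℍ[ℚ,((-1 : ℤ) : ℚ),((3 : ℤ) : ℚ)] // (u ∈ order (-1) 3 ∨ u - ⟨1/2, 1/2, 1/2, -1/2⟩ ∈ order (-1) 3) ∧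
            ((u * star u).re = 1 ∨ (u * star u).re = -1) ∧
            u * ⟨0, q.out.1.1, q.out.1.2.1, q.out.1.2.2⟩ = ⟨0, q.out.1.1, q.out.1.2.1, q.out.1.2.2⟩ * u} : ℚ))⁻¹ :=
  finsum_scale_engine₃₉ 2 (by norm_num) (norm_four_mul_iff t)

/-- **`Σᶠ_{L(9t)/O₆^×} e⁻¹ = Σᶠ_{L(t)/O₆^×} e⁻¹` FOR EVERY `t`: `deg Z(9t)_ℚ = deg Z(t)_ℚ` on `X₆`** — the descent
`L(9t) = 3·L(t)` at the ramified prime `3 ∣ D(B)`, and `e_{3y} = e_y`; on the class-number side `4·(9t) = (3n)²d`,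
`Σ_{c ∣ 3n, (c,6)=1} = Σ_{c ∣ n, (c,6)=1}`. [cite: KudlaRapoportYang2006, §3.4 (3.4.4)–(3.4.6), (3.4.14) and Remark 3.4.7] [cite: VignerasLNM800, Ch. II §3 and Ch. III §5] -/
theorem finsum_unit_classes_nine_mul_eq (t : ℤ) :
    ∑ᶠ q : (Quot (fun x y : {x : ℤ × ℤ × ℤ // x.1 ^ 2 - 3 * x.2.1 ^ 2 - 3 * x.2.2 ^ 2 = 9 * t} ↦
      ∃ v : ℍ[ℚ,((-1 : ℤ) : ℚ),((3 : ℤ) : ℚ)], (v ∈ order (-1) 3 ∨ v - ⟨1/2, 1/2, 1/2, -1/2⟩ ∈ order (-1) 3) ∧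
        ((v * star v).re = 1 ∨ (v * star v).re = -1) ∧
        v * ⟨0, x.1.1, x.1.2.1, x.1.2.2⟩ = ⟨0, y.1.1, y.1.2.1, y.1.2.2⟩ * v)),
        ((Nat.card
          {u : ℍ[ℚ,((-1 : ℤ) : ℚ),((3 : ℤ) : ℚ)] // (u ∈ order (-1) 3 ∨ u - ⟨1/2, 1/2, 1/2, -1/2⟩ ∈ order (-1) 3) ∧
            ((u * star u).re = 1 ∨ (u * star u).re = -1) ∧
            u * ⟨0, q.out.1.1, q.out.1.2.1, q.out.1.2.2⟩ = ⟨0, q.out.1.1, q.out.1.2.1, q.out.1.2.2⟩ * u} : ℚ))⁻¹ =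
    ∑ᶠ q : (Quot (fun x y : {x : ℤ × ℤ × ℤ // x.1 ^ 2 - 3 * x.2.1 ^ 2 - 3 * x.2.2 ^ 2 = t} ↦
      ∃ v : ℍ[ℚ,((-1 : ℤ) : ℚ),((3 : ℤ) : ℚ)], (v ∈ order (-1) 3 ∨ v - ⟨1/2, 1/2, 1/2, -1/2⟩ ∈ order (-1) 3) ∧
        ((v * star v).re = 1 ∨ (v * star v).re = -1) ∧
        v * ⟨0, x.1.1, x.1.2.1, x.1.2.2⟩ = ⟨0, y.1.1, y.1.2.1, y.1.2.2⟩ * v)),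
        ((Nat.card
          {u : ℍ[ℚ,((-1 : ℤ) : ℚ),((3 : ℤ) : ℚ)] // (u ∈ order (-1) 3 ∨ u - ⟨1/2, 1/2, 1/2, -1/2⟩ ∈ order (-1) 3) ∧
            ((u * star u).re = 1 ∨ (u * star u).re = -1) ∧
            u * ⟨0, q.out.1.1, q.out.1.2.1, q.out.1.2.2⟩ = ⟨0, q.out.1.1, q.out.1.2.1, q.out.1.2.2⟩ * u} : ℚ))⁻¹ :=
  finsum_scale_engine₃₉ 3 (by norm_num) (norm_nine_mul_iff t)

/-- Transport of the degree sum along an equality of norms. [folklore] -/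
private theorem finsum_unit_classes_congr₃₉ {t₁ t₂ : ℤ} (h : t₁ = t₂) :
    ∑ᶠ q : (Quot (fun x y : {x : ℤ × ℤ × ℤ // x.1 ^ 2 - 3 * x.2.1 ^ 2 - 3 * x.2.2 ^ 2 = t₁} ↦
      ∃ v : ℍ[ℚ,((-1 : ℤ) : ℚ),((3 : ℤ) : ℚ)], (v ∈ order (-1) 3 ∨ v - ⟨1/2, 1/2, 1/2, -1/2⟩ ∈ order (-1) 3) ∧
        ((v * star v).re = 1 ∨ (v * star v).re = -1) ∧
        v * ⟨0, x.1.1, x.1.2.1, x.1.2.2⟩ = ⟨0, y.1.1, y.1.2.1, y.1.2.2⟩ * v)),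
        ((Nat.card
          {u : ℍ[ℚ,((-1 : ℤ) : ℚ),((3 : ℤ) : ℚ)] // (u ∈ order (-1) 3 ∨ u - ⟨1/2, 1/2, 1/2, -1/2⟩ ∈ order (-1) 3) ∧
            ((u * star u).re = 1 ∨ (u * star u).re = -1) ∧
            u * ⟨0, q.out.1.1, q.out.1.2.1, q.out.1.2.2⟩ = ⟨0, q.out.1.1, q.out.1.2.1, q.out.1.2.2⟩ * u} : ℚ))⁻¹ =
    ∑ᶠ q : (Quot (fun x y : {x : ℤ × ℤ × ℤ // x.1 ^ 2 - 3 * x.2.1 ^ 2 - 3 * x.2.2 ^ 2 = t₂} ↦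
      ∃ v : ℍ[ℚ,((-1 : ℤ) : ℚ),((3 : ℤ) : ℚ)], (v ∈ order (-1) 3 ∨ v - ⟨1/2, 1/2, 1/2, -1/2⟩ ∈ order (-1) 3) ∧
        ((v * star v).re = 1 ∨ (v * star v).re = -1) ∧
        v * ⟨0, x.1.1, x.1.2.1, x.1.2.2⟩ = ⟨0, y.1.1, y.1.2.1, y.1.2.2⟩ * v)),
        ((Nat.card
          {u : ℍ[ℚ,((-1 : ℤ) : ℚ),((3 : ℤ) : ℚ)] // (u ∈ order (-1) 3 ∨ u - ⟨1/2, 1/2, 1/2, -1/2⟩ ∈ order (-1) 3) ∧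
            ((u * star u).re = 1 ∨ (u * star u).re = -1) ∧
            u * ⟨0, q.out.1.1, q.out.1.2.1, q.out.1.2.2⟩ = ⟨0, q.out.1.1, q.out.1.2.1, q.out.1.2.2⟩ * u} : ℚ))⁻¹ := by
  subst h
  rfl

/-- **`deg Z(4^a·9^b·t)_ℚ = deg Z(t)_ℚ` on `X₆` for all `a, b` and every `t`** — the part of `t` supported at the ramified
primes `2, 3` of `B` is invisible to the degree. [cite: KudlaRapoportYang2006, §3.4 (3.4.4)–(3.4.6) («`(c, D) = 1`») and (3.4.14)] -/
theorem finsum_unit_classes_pow_mul_eq (t : ℤ) (a b : ℕ) :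
    ∑ᶠ q : (Quot (fun x y : {x : ℤ × ℤ × ℤ // x.1 ^ 2 - 3 * x.2.1 ^ 2 - 3 * x.2.2 ^ 2 = 4 ^ a * 9 ^ b * t} ↦
      ∃ v : ℍ[ℚ,((-1 : ℤ) : ℚ),((3 : ℤ) : ℚ)], (v ∈ order (-1) 3 ∨ v - ⟨1/2, 1/2, 1/2, -1/2⟩ ∈ order (-1) 3) ∧
        ((v * star v).re = 1 ∨ (v * star v).re = -1) ∧
        v * ⟨0, x.1.1, x.1.2.1, x.1.2.2⟩ = ⟨0, y.1.1, y.1.2.1, y.1.2.2⟩ * v)),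
        ((Nat.card
          {u : ℍ[ℚ,((-1 : ℤ) : ℚ),((3 : ℤ) : ℚ)] // (u ∈ order (-1) 3 ∨ u - ⟨1/2, 1/2, 1/2, -1/2⟩ ∈ order (-1) 3) ∧
            ((u * star u).re = 1 ∨ (u * star u).re = -1) ∧
            u * ⟨0, q.out.1.1, q.out.1.2.1, q.out.1.2.2⟩ = ⟨0, q.out.1.1, q.out.1.2.1, q.out.1.2.2⟩ * u} : ℚ))⁻¹ =
    ∑ᶠ q : (Quot (fun x y : {x : ℤ × ℤ × ℤ // x.1 ^ 2 - 3 * x.2.1 ^ 2 - 3 * x.2.2 ^ 2 = t} ↦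
      ∃ v : ℍ[ℚ,((-1 : ℤ) : ℚ),((3 : ℤ) : ℚ)], (v ∈ order (-1) 3 ∨ v - ⟨1/2, 1/2, 1/2, -1/2⟩ ∈ order (-1) 3) ∧
        ((v * star v).re = 1 ∨ (v * star v).re = -1) ∧
        v * ⟨0, x.1.1, x.1.2.1, x.1.2.2⟩ = ⟨0, y.1.1, y.1.2.1, y.1.2.2⟩ * v)),
        ((Nat.card
          {u : ℍ[ℚ,((-1 : ℤ) : ℚ),((3 : ℤ) : ℚ)] // (u ∈ order (-1) 3 ∨ u - ⟨1/2, 1/2, 1/2, -1/2⟩ ∈ order (-1) 3) ∧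
            ((u * star u).re = 1 ∨ (u * star u).re = -1) ∧
            u * ⟨0, q.out.1.1, q.out.1.2.1, q.out.1.2.2⟩ = ⟨0, q.out.1.1, q.out.1.2.1, q.out.1.2.2⟩ * u} : ℚ))⁻¹ := by
  induction a with
  | zero =>
    induction b with
    | zero => exact finsum_unit_classes_congr₃₉ (by ring)
    | succ b ih =>
      rw [finsum_unit_classes_congr₃₉ (show (4 : ℤ) ^ 0 * 9 ^ (b + 1) * t = 9 * (4 ^ 0 * 9 ^ b * t) by ring),
        finsum_unit_classes_nine_mul_eq, ih]
  | succ a ih =>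
    rw [finsum_unit_classes_congr₃₉ (show (4 : ℤ) ^ (a + 1) * 9 ^ b * t = 4 * (4 ^ a * 9 ^ b * t) by ring),
      finsum_unit_classes_four_mul_eq, ih]

/-- **The class-number side at the prime `2`: `Σ_{c ∣ 2n, (c,6)=1} f(c) = Σ_{c ∣ n, (c,6)=1} f(c)`** — a divisor of `2n`
prime to `6` divides `n`; with `4·(4t) = (2n)²d` (same fundamental `d`, same `δ(d, D)`) this is `H₀(4t; 6) = H₀(t; 6)` for
KRY's restricted sum `(c, D) = 1`. [cite: KudlaRapoportYang2006, §3.4 (3.4.5)–(3.4.6) («`(c, D) = 1`»)] -/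
theorem sum_divisors_two_mul_filter_coprime_six (n : ℕ) (f : ℕ → ℚ) :
    ∑ c ∈ Nat.divisors (2 * n) with Nat.Coprime c 6, f c = ∑ c ∈ Nat.divisors n with Nat.Coprime c 6, f c := by
  rcases Nat.eq_zero_or_pos n with rfl | hn
  · simp
  refine Finset.sum_congr ?_ fun _ _ ↦ rfl
  ext c
  simp only [Finset.mem_filter, Nat.mem_divisors]
  constructor
  · rintro ⟨⟨hd, -⟩, hc⟩
    have h2 : Nat.Coprime c 2 := Nat.Coprime.coprime_dvd_right (by norm_num : 2 ∣ 6) hc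
    exact ⟨⟨h2.dvd_of_dvd_mul_left hd, hn.ne'⟩, hc⟩
  · rintro ⟨⟨hd, -⟩, hc⟩
    exact ⟨⟨Dvd.dvd.mul_left hd 2, by omega⟩, hc⟩

/-- **The class-number side at the prime `3`: `Σ_{c ∣ 3n, (c,6)=1} f(c) = Σ_{c ∣ n, (c,6)=1} f(c)`** (`4·(9t) = (3n)²d`:
`H₀(9t; 6) = H₀(t; 6)`). [cite: KudlaRapoportYang2006, §3.4 (3.4.5)–(3.4.6) («`(c, D) = 1`»)] -/
theorem sum_divisors_three_mul_filter_coprime_six (n : ℕ) (f : ℕ → ℚ) :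
    ∑ c ∈ Nat.divisors (3 * n) with Nat.Coprime c 6, f c = ∑ c ∈ Nat.divisors n with Nat.Coprime c 6, f c := by
  rcases Nat.eq_zero_or_pos n with rfl | hn
  · simp
  refine Finset.sum_congr ?_ fun _ _ ↦ rfl
  ext c
  simp only [Finset.mem_filter, Nat.mem_divisors]
  constructor
  · rintro ⟨⟨hd, -⟩, hc⟩
    have h3 : Nat.Coprime c 3 := Nat.Coprime.coprime_dvd_right (by norm_num : 3 ∣ 6) hc
    exact ⟨⟨h3.dvd_of_dvd_mul_left hd, hn.ne'⟩, hc⟩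
  · rintro ⟨⟨hd, -⟩, hc⟩
    exact ⟨⟨Dvd.dvd.mul_left hd 3, by omega⟩, hc⟩

/-- **Both sides of (3.4.14) = (3.4.4)·(3.4.6) are invariant under `t ↦ 4t`, `n ↦ 2n`** (`D(B) = 6`): the right side
`2δ(d,6)·Σ_{c ∣ n, (c,6)=1} h(−c²d)/w(−c²d)` does not change when `n` is doubled. [cite: KudlaRapoportYang2006, §3.4 (3.4.4)–(3.4.6)] -/
theorem degree_rhs_two_mul_eq (d : ℤ) (n : ℕ) :
    2 * ((((1 - ZMod.χ₈ ((-d : ℤ) : ZMod 8)) * (1 - legendreSym 3 (-d)) : ℤ)) : ℚ) *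
        ∑ c ∈ Nat.divisors (2 * n) with Nat.Coprime c 6,
          (BinQF.classNumber (-((c : ℤ) ^ 2 * d)) : ℚ) /
            (if (c : ℤ) ^ 2 * d = 3 then 6 else if (c : ℤ) ^ 2 * d = 4 then 4 else 2) =
    2 * ((((1 - ZMod.χ₈ ((-d : ℤ) : ZMod 8)) * (1 - legendreSym 3 (-d)) : ℤ)) : ℚ) *
        ∑ c ∈ Nat.divisors n with Nat.Coprime c 6,
          (BinQF.classNumber (-((c : ℤ) ^ 2 * d)) : ℚ) /
            (if (c : ℤ) ^ 2 * d = 3 then 6 else if (c : ℤ) ^ 2 * d = 4 then 4 else 2) := by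
  rw [sum_divisors_two_mul_filter_coprime_six]

/-- **… and under `t ↦ 9t`, `n ↦ 3n`.** [cite: KudlaRapoportYang2006, §3.4 (3.4.4)–(3.4.6)] -/
theorem degree_rhs_three_mul_eq (d : ℤ) (n : ℕ) :
    2 * ((((1 - ZMod.χ₈ ((-d : ℤ) : ZMod 8)) * (1 - legendreSym 3 (-d)) : ℤ)) : ℚ) *
        ∑ c ∈ Nat.divisors (3 * n) with Nat.Coprime c 6,
          (BinQF.classNumber (-((c : ℤ) ^ 2 * d)) : ℚ) /
            (if (c : ℤ) ^ 2 * d = 3 then 6 else if (c : ℤ) ^ 2 * d = 4 then 4 else 2) =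
    2 * ((((1 - ZMod.χ₈ ((-d : ℤ) : ZMod 8)) * (1 - legendreSym 3 (-d)) : ℤ)) : ℚ) *
        ∑ c ∈ Nat.divisors n with Nat.Coprime c 6,
          (BinQF.classNumber (-((c : ℤ) ^ 2 * d)) : ℚ) /
            (if (c : ℤ) ^ 2 * d = 3 then 6 else if (c : ℤ) ^ 2 * d = 4 then 4 else 2) := by
  rw [sum_divisors_three_mul_filter_coprime_six]

end Scaling

/-! ## §4 The reduction of `Σᶠ_{L(t)/O₆^×} e⁻¹` to the primitive class numbers `|L_c(t)/O₆^×|` -/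

section Content

/-- **`e` ON A CONTENT STRATUM IS THE CONSTANT `w_c(t)`**: for `p` primitive with `c²Q(p) = t > 0` (`c ≥ 1`), the
stabiliser of `c·p̂` in `O₆^×` has `4` elements if `c² = t` (`Q(p̂) = 1`: `ℤ[i]^×`), `6` if `3c² = t` (`Q(p̂) = 3`:
`ℤ[ζ₃]^×`), and `2` otherwise (`±1`) — KRY's `w(c²d) = |O_{c²d}^×|` read on the vector side. [cite: KudlaRapoportYang2006, §3.4 (3.4.6) («`w(c²d)` is the number of units in `O_{c²d}`») and (3.4.14)] [cite: BayerTravesa2007, §1 Thm. 1.1] -/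
theorem card_unitStab_content_smul_primitive {t : ℤ} (ht : 0 < t) {c : ℕ} (hc : 0 < c) {x : ℤ × ℤ × ℤ}
    (hQ : (c : ℤ) ^ 2 * (x.1 ^ 2 - 3 * x.2.1 ^ 2 - 3 * x.2.2 ^ 2) = t)
    (hx : ∃ u : ℤ × ℤ × ℤ, u.1 * x.1 + u.2.1 * x.2.1 + u.2.2 * x.2.2 = 1) :
    (Nat.card {u : ℍ[ℚ,((-1 : ℤ) : ℚ),((3 : ℤ) : ℚ)] // (u ∈ order (-1) 3 ∨ u - ⟨1/2, 1/2, 1/2, -1/2⟩ ∈ order (-1) 3) ∧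
        ((u * star u).re = 1 ∨ (u * star u).re = -1) ∧ u * ((c : ℚ) • (⟨0, x.1, x.2.1, x.2.2⟩ : ℍ[ℚ,((-1 : ℤ) : ℚ),((3 : ℤ) : ℚ)])) = ((c : ℚ) • (⟨0, x.1, x.2.1, x.2.2⟩ : ℍ[ℚ,((-1 : ℤ) : ℚ),((3 : ℤ) : ℚ)])) * u} : ℚ) =
      (if (c : ℤ) ^ 2 = t then 4 else if (c : ℤ) ^ 2 * 3 = t then 6 else 2) := by
  have hcq : (c : ℚ) ≠ 0 := by positivity
  have hprim := prim_fin₃₉ hx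
  have hX : (c : ℚ) • (⟨0, x.1, x.2.1, x.2.2⟩ : ℍ[ℚ,((-1 : ℤ) : ℚ),((3 : ℤ) : ℚ)]) = (c : ℚ) • (⟨0, (![x.1, x.2.1, x.2.2] : Fin 3 → ℤ) 0, (![x.1, x.2.1, x.2.2] : Fin 3 → ℤ) 1, (![x.1, x.2.1, x.2.2] : Fin 3 → ℤ) 2⟩ : ℍ[ℚ,((-1 : ℤ) : ℚ),((3 : ℤ) : ℚ)]) := by
    rw [fin_pureVec₃₉]
  have hc2 : (0 : ℤ) < (c : ℤ) ^ 2 := by positivity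
  generalize hq : x.1 ^ 2 - 3 * x.2.1 ^ 2 - 3 * x.2.2 ^ 2 = q at hQ
  have hQF : ((![x.1, x.2.1, x.2.2] : Fin 3 → ℤ) 0 ^ 2 - 3 * (![x.1, x.2.1, x.2.2] : Fin 3 → ℤ) 1 ^ 2 - 3 * (![x.1, x.2.1, x.2.2] : Fin 3 → ℤ) 2 ^ 2) = q := by rw [fin_normForm₃₉, hq]
  have hq0 : 0 < q := pos_of_mul_pos_right (by rw [hQ]; exact ht) hc2.le
  by_cases h1 : (c : ℤ) ^ 2 = t
  · have hq1 : q = 1 := by nlinarith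
    rw [if_pos h1]
    exact_mod_cast card_unitStab_eq_four hcq hprim hX (by rw [hQF, hq1])
  · by_cases h3 : (c : ℤ) ^ 2 * 3 = t
    · have hq3 : q = 3 := by nlinarith
      rw [if_neg h1, if_pos h3]
      exact_mod_cast card_unitStab_eq_six hcq hprim hX (by rw [hQF, hq3])
    · have hq1 : q ≠ 1 := fun h ↦ h1 (by rw [← hQ, h, mul_one])
      have hq3 : q ≠ 3 := fun h ↦ h3 (by rw [← hQ, h])
      rw [if_neg h1, if_neg h3]
      exact_mod_cast card_unitStab_eq_two hcq hprim hX (by rw [hQF]; omega) (by rw [hQF]; exact hq3)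

/-- **THE REDUCTION TO PRIMITIVE CLASS NUMBERS: `Σᶠ_{[x] ∈ L(t)/O₆^×} e_x⁻¹ = Σ_{c=1}^{t} |L_c(t)/O₆^×| / w_c(t)` FOR
EVERY `t > 0`**, `L_c(t)` = primitive `p` with `c²Q(p) = t` (empty unless `c² ∣ t`), `w_c(t) = 4, 6, 2` according as
`t/c² = 1`, `3`, or else — the content stratification `(c, [p̂]) ↦ [c·p̂]` is a bijection `⊔_c L_c(t)/O₆^× → L(t)/O₆^×`
(content and primitive part are `O₆^×`-invariants; every vector is `c·p̂`) along which `e = w_c(t)`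
(`card_unitStab_content_smul_primitive`). So KRY's (3.4.14) reads `deg Z(t)_ℚ = 2·Σ_{c² ∣ t} |L_prim(t/c²)/O₆^×|/w(t/c²)`,
the vector-side SHAPE of `2δ(d;D)·Σ_{c ∣ n} h(c²d)/w(c²d)` (3.4.4)–(3.4.6); identifying the strata with class numbers is
Eichler's theorem, not proved here. [cite: KudlaRapoportYang2006, §3.4 (3.4.4)–(3.4.6) and (3.4.13)–(3.4.14)] [cite: VignerasLNM800, Ch. III §5.C Cor. 5.12–5.14 p. 82–83 («`Σ_B m_G(B)` où `B` parcourt les ordres de `K(h)` contenant `h`»)] -/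
theorem finsum_unit_classes_eq_sum_content {t : ℤ} (ht : 0 < t) :
    ∑ᶠ q : (Quot (fun x y : {x : ℤ × ℤ × ℤ // x.1 ^ 2 - 3 * x.2.1 ^ 2 - 3 * x.2.2 ^ 2 = t} ↦
      ∃ v : ℍ[ℚ,((-1 : ℤ) : ℚ),((3 : ℤ) : ℚ)], (v ∈ order (-1) 3 ∨ v - ⟨1/2, 1/2, 1/2, -1/2⟩ ∈ order (-1) 3) ∧
        ((v * star v).re = 1 ∨ (v * star v).re = -1) ∧
        v * ⟨0, x.1.1, x.1.2.1, x.1.2.2⟩ = ⟨0, y.1.1, y.1.2.1, y.1.2.2⟩ * v)),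
        ((Nat.card
          {u : ℍ[ℚ,((-1 : ℤ) : ℚ),((3 : ℤ) : ℚ)] // (u ∈ order (-1) 3 ∨ u - ⟨1/2, 1/2, 1/2, -1/2⟩ ∈ order (-1) 3) ∧
            ((u * star u).re = 1 ∨ (u * star u).re = -1) ∧
            u * ⟨0, q.out.1.1, q.out.1.2.1, q.out.1.2.2⟩ = ⟨0, q.out.1.1, q.out.1.2.1, q.out.1.2.2⟩ * u} : ℚ))⁻¹ =
    ∑ c ∈ Finset.Icc 1 t.toNat,
      (Nat.card (Quot (fun x y : {x : ℤ × ℤ × ℤ // (c : ℤ) ^ 2 * (x.1 ^ 2 - 3 * x.2.1 ^ 2 - 3 * x.2.2 ^ 2) = t ∧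
      ∃ u : ℤ × ℤ × ℤ, u.1 * x.1 + u.2.1 * x.2.1 + u.2.2 * x.2.2 = 1} ↦
      ∃ v : ℍ[ℚ,((-1 : ℤ) : ℚ),((3 : ℤ) : ℚ)], (v ∈ order (-1) 3 ∨ v - ⟨1/2, 1/2, 1/2, -1/2⟩ ∈ order (-1) 3) ∧
        ((v * star v).re = 1 ∨ (v * star v).re = -1) ∧
        v * ⟨0, x.1.1, x.1.2.1, x.1.2.2⟩ = ⟨0, y.1.1, y.1.2.1, y.1.2.2⟩ * v)) : ℚ) /
        (if (c : ℤ) ^ 2 = t then 4 else if (c : ℤ) ^ 2 * 3 = t then 6 else 2) := by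
  classical
  set I : Finset ℕ := Finset.Icc 1 t.toNat with hI
  set R : {x : ℤ × ℤ × ℤ // x.1 ^ 2 - 3 * x.2.1 ^ 2 - 3 * x.2.2 ^ 2 = t} → {x : ℤ × ℤ × ℤ // x.1 ^ 2 - 3 * x.2.1 ^ 2 - 3 * x.2.2 ^ 2 = t} → Prop := (fun x y : {x : ℤ × ℤ × ℤ // x.1 ^ 2 - 3 * x.2.1 ^ 2 - 3 * x.2.2 ^ 2 = t} ↦
      ∃ v : ℍ[ℚ,((-1 : ℤ) : ℚ),((3 : ℤ) : ℚ)], (v ∈ order (-1) 3 ∨ v - ⟨1/2, 1/2, 1/2, -1/2⟩ ∈ order (-1) 3) ∧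
        ((v * star v).re = 1 ∨ (v * star v).re = -1) ∧
        v * ⟨0, x.1.1, x.1.2.1, x.1.2.2⟩ = ⟨0, y.1.1, y.1.2.1, y.1.2.2⟩ * v) with hR
  haveI : Finite (Quot R) := finite_unit_classes ht
  have hiff : ∀ x y, Quot.mk R x = Quot.mk R y ↔ R x y := unit_conj_mk_eq_iff t
  -- the scaling maps `p ↦ c·p`
  have mem : ∀ (c : ℕ) (x : {x : ℤ × ℤ × ℤ // (c : ℤ) ^ 2 * (x.1 ^ 2 - 3 * x.2.1 ^ 2 - 3 * x.2.2 ^ 2) = t ∧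
      ∃ u : ℤ × ℤ × ℤ, u.1 * x.1 + u.2.1 * x.2.1 + u.2.2 * x.2.2 = 1}),
      ((c : ℤ) * x.1.1) ^ 2 - 3 * ((c : ℤ) * x.1.2.1) ^ 2 - 3 * ((c : ℤ) * x.1.2.2) ^ 2 = t := fun c x ↦ by
    linear_combination x.2.1
  set sc : ∀ c : ℕ, {x : ℤ × ℤ × ℤ // (c : ℤ) ^ 2 * (x.1 ^ 2 - 3 * x.2.1 ^ 2 - 3 * x.2.2 ^ 2) = t ∧
      ∃ u : ℤ × ℤ × ℤ, u.1 * x.1 + u.2.1 * x.2.1 + u.2.2 * x.2.2 = 1} → {x : ℤ × ℤ × ℤ // x.1 ^ 2 - 3 * x.2.1 ^ 2 - 3 * x.2.2 ^ 2 = t} :=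
    fun c x ↦ ⟨((c : ℤ) * x.1.1, (c : ℤ) * x.1.2.1, (c : ℤ) * x.1.2.2), mem c x⟩ with hsc
  have sc_vec : ∀ (c : ℕ) (x : {x : ℤ × ℤ × ℤ // (c : ℤ) ^ 2 * (x.1 ^ 2 - 3 * x.2.1 ^ 2 - 3 * x.2.2 ^ 2) = t ∧
      ∃ u : ℤ × ℤ × ℤ, u.1 * x.1 + u.2.1 * x.2.1 + u.2.2 * x.2.2 = 1}), (⟨0, (sc c x).1.1, (sc c x).1.2.1, (sc c x).1.2.2⟩ : ℍ[ℚ,((-1 : ℤ) : ℚ),((3 : ℤ) : ℚ)]) = (c : ℚ) • ⟨0, x.1.1, x.1.2.1, x.1.2.2⟩ :=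
    fun c x ↦ (natSmul_pureVec₃₉ c x.1).symm
  have hcpos : ∀ c : ↥I, 0 < (c : ℕ) := fun c ↦ (Finset.mem_Icc.1 c.2).1
  have hcq : ∀ c : ↥I, ((c : ℕ) : ℚ) ≠ 0 := fun c ↦ by have := hcpos c; positivity
  have csc : ∀ (c : ↥I) (x y : {x : ℤ × ℤ × ℤ // ((c : ℕ) : ℤ) ^ 2 * (x.1 ^ 2 - 3 * x.2.1 ^ 2 - 3 * x.2.2 ^ 2) = t ∧
      ∃ u : ℤ × ℤ × ℤ, u.1 * x.1 + u.2.1 * x.2.1 + u.2.2 * x.2.2 = 1}), (∃ v : ℍ[ℚ,((-1 : ℤ) : ℚ),((3 : ℤ) : ℚ)], (v ∈ order (-1) 3 ∨ v - ⟨1/2, 1/2, 1/2, -1/2⟩ ∈ order (-1) 3) ∧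
        ((v * star v).re = 1 ∨ (v * star v).re = -1) ∧
        v * ⟨0, x.1.1, x.1.2.1, x.1.2.2⟩ = ⟨0, y.1.1, y.1.2.1, y.1.2.2⟩ * v) → R (sc c x) (sc c y) := by
    rintro c x y ⟨g, hg, hn, h⟩
    refine ⟨g, hg, hn, ?_⟩
    rw [sc_vec, sc_vec, conj_ratSmul_iff (hcq c)]
    exact h
  set Φ : (Σ c : ↥I, (Quot (fun x y : {x : ℤ × ℤ × ℤ // ((c : ℕ) : ℤ) ^ 2 * (x.1 ^ 2 - 3 * x.2.1 ^ 2 - 3 * x.2.2 ^ 2) = t ∧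
      ∃ u : ℤ × ℤ × ℤ, u.1 * x.1 + u.2.1 * x.2.1 + u.2.2 * x.2.2 = 1} ↦
      ∃ v : ℍ[ℚ,((-1 : ℤ) : ℚ),((3 : ℤ) : ℚ)], (v ∈ order (-1) 3 ∨ v - ⟨1/2, 1/2, 1/2, -1/2⟩ ∈ order (-1) 3) ∧
        ((v * star v).re = 1 ∨ (v * star v).re = -1) ∧
        v * ⟨0, x.1.1, x.1.2.1, x.1.2.2⟩ = ⟨0, y.1.1, y.1.2.1, y.1.2.2⟩ * v))) → Quot R :=
    fun s ↦ Quot.map (sc s.1) (csc s.1) s.2 with hΦ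
  have hinj : Function.Injective Φ := by
    rintro ⟨c, a⟩ ⟨c', b⟩
    induction a using Quot.ind with
    | _ x =>
    induction b using Quot.ind with
    | _ x' =>
      intro h
      change Quot.mk R (sc c x) = Quot.mk R (sc c' x') at h
      rw [hiff] at h
      obtain ⟨g, hg, hn, hconj⟩ := h
      rw [sc_vec, sc_vec] at hconj
      obtain ⟨hcc, hconj'⟩ := content_eq_of_unit_conj₃₉ hg hn (hcpos c) x.2.2 x'.2.2 hconj
      obtain ⟨c, hcI⟩ := c
      obtain ⟨c', hc'I⟩ := c'
      simp only at hcc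
      subst hcc
      exact congrArg (Sigma.mk _) (Quot.sound ⟨g, hg, hn, hconj'⟩)
  have hsurj : Function.Surjective Φ := by
    intro q
    induction q using Quot.ind with
    | _ x =>
      obtain ⟨g, p, hg, hp, hxe, hQ⟩ := exists_content_of_mem t ht.ne' x
      have hprim : ∃ u : ℤ × ℤ × ℤ, u.1 * (p 0, p 1, p 2).1 + u.2.1 * (p 0, p 1, p 2).2.1 +
          u.2.2 * (p 0, p 1, p 2).2.2 = 1 := by
        obtain ⟨u, hu⟩ := hp
        exact ⟨(u 0, u 1, u 2), by simpa [Fin.sum_univ_three] using hu⟩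
      have hQ' : (g : ℤ) ^ 2 * ((p 0, p 1, p 2).1 ^ 2 - 3 * (p 0, p 1, p 2).2.1 ^ 2 - 3 * (p 0, p 1, p 2).2.2 ^ 2) = t := hQ
      refine ⟨⟨⟨g, content_mem_Icc₃₉ ht hg hQ⟩, Quot.mk _ ⟨(p 0, p 1, p 2), hQ', hprim⟩⟩, ?_⟩
      change Quot.mk R (sc g ⟨(p 0, p 1, p 2), hQ', hprim⟩) = Quot.mk R x
      congr 1
      apply Subtype.ext
      rw [show (g : ℚ) = ((g : ℤ) : ℚ) by simp, intCast_smul_pureVec] at hxe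
      have e := hxe
      simp only [QuaternionAlgebra.mk.injEq, Int.cast_inj, true_and] at e
      obtain ⟨e1, e2, e3⟩ := e
      exact Prod.ext e1.symm (Prod.ext e2.symm e3.symm)
  haveI hfin : ∀ c : ↥I, Finite (Quot (fun x y : {x : ℤ × ℤ × ℤ // ((c : ℕ) : ℤ) ^ 2 * (x.1 ^ 2 - 3 * x.2.1 ^ 2 - 3 * x.2.2 ^ 2) = t ∧
      ∃ u : ℤ × ℤ × ℤ, u.1 * x.1 + u.2.1 * x.2.1 + u.2.2 * x.2.2 = 1} ↦
      ∃ v : ℍ[ℚ,((-1 : ℤ) : ℚ),((3 : ℤ) : ℚ)], (v ∈ order (-1) 3 ∨ v - ⟨1/2, 1/2, 1/2, -1/2⟩ ∈ order (-1) 3) ∧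
        ((v * star v).re = 1 ∨ (v * star v).re = -1) ∧
        v * ⟨0, x.1.1, x.1.2.1, x.1.2.2⟩ = ⟨0, y.1.1, y.1.2.1, y.1.2.2⟩ * v)) := fun c ↦
    Finite.of_injective (fun b ↦ Φ ⟨c, b⟩) fun a b h ↦ eq_of_heq (Sigma.mk.inj_iff.1 (hinj h)).2
  haveI : ∀ c : ↥I, Fintype (Quot (fun x y : {x : ℤ × ℤ × ℤ // ((c : ℕ) : ℤ) ^ 2 * (x.1 ^ 2 - 3 * x.2.1 ^ 2 - 3 * x.2.2 ^ 2) = t ∧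
      ∃ u : ℤ × ℤ × ℤ, u.1 * x.1 + u.2.1 * x.2.1 + u.2.2 * x.2.2 = 1} ↦
      ∃ v : ℍ[ℚ,((-1 : ℤ) : ℚ),((3 : ℤ) : ℚ)], (v ∈ order (-1) 3 ∨ v - ⟨1/2, 1/2, 1/2, -1/2⟩ ∈ order (-1) 3) ∧
        ((v * star v).re = 1 ∨ (v * star v).re = -1) ∧
        v * ⟨0, x.1.1, x.1.2.1, x.1.2.2⟩ = ⟨0, y.1.1, y.1.2.1, y.1.2.2⟩ * v)) := fun c ↦ Fintype.ofFinite _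
  have hout : ∀ y : {x : ℤ × ℤ × ℤ // x.1 ^ 2 - 3 * x.2.1 ^ 2 - 3 * x.2.2 ^ 2 = t}, Nat.card {u : ℍ[ℚ,((-1 : ℤ) : ℚ),((3 : ℤ) : ℚ)] // (u ∈ order (-1) 3 ∨ u - ⟨1/2, 1/2, 1/2, -1/2⟩ ∈ order (-1) 3) ∧ ((u * star u).re = 1 ∨ (u * star u).re = -1) ∧ u * (⟨0, ((Quot.mk R y).out).1.1, ((Quot.mk R y).out).1.2.1, ((Quot.mk R y).out).1.2.2⟩ : ℍ[ℚ,((-1 : ℤ) : ℚ),((3 : ℤ) : ℚ)]) = (⟨0, ((Quot.mk R y).out).1.1, ((Quot.mk R y).out).1.2.1, ((Quot.mk R y).out).1.2.2⟩ : ℍ[ℚ,((-1 : ℤ) : ℚ),((3 : ℤ) : ℚ)]) * u} =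
      Nat.card {u : ℍ[ℚ,((-1 : ℤ) : ℚ),((3 : ℤ) : ℚ)] // (u ∈ order (-1) 3 ∨ u - ⟨1/2, 1/2, 1/2, -1/2⟩ ∈ order (-1) 3) ∧ ((u * star u).re = 1 ∨ (u * star u).re = -1) ∧ u * (⟨0, y.1.1, y.1.2.1, y.1.2.2⟩ : ℍ[ℚ,((-1 : ℤ) : ℚ),((3 : ℤ) : ℚ)]) = (⟨0, y.1.1, y.1.2.1, y.1.2.2⟩ : ℍ[ℚ,((-1 : ℤ) : ℚ),((3 : ℤ) : ℚ)]) * u} := card_unitStab_mk_out t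
  -- transport the weighted sum along `Φ` and evaluate stratum by stratum
  rw [← finsum_comp Φ ⟨hinj, hsurj⟩, finsum_eq_sum_of_fintype, Fintype.sum_sigma, ← Finset.sum_coe_sort I]
  refine Finset.sum_congr rfl fun c _ ↦ ?_
  have hconst : ∀ b : (Quot (fun x y : {x : ℤ × ℤ × ℤ // ((c : ℕ) : ℤ) ^ 2 * (x.1 ^ 2 - 3 * x.2.1 ^ 2 - 3 * x.2.2 ^ 2) = t ∧
      ∃ u : ℤ × ℤ × ℤ, u.1 * x.1 + u.2.1 * x.2.1 + u.2.2 * x.2.2 = 1} ↦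
      ∃ v : ℍ[ℚ,((-1 : ℤ) : ℚ),((3 : ℤ) : ℚ)], (v ∈ order (-1) 3 ∨ v - ⟨1/2, 1/2, 1/2, -1/2⟩ ∈ order (-1) 3) ∧
        ((v * star v).re = 1 ∨ (v * star v).re = -1) ∧
        v * ⟨0, x.1.1, x.1.2.1, x.1.2.2⟩ = ⟨0, y.1.1, y.1.2.1, y.1.2.2⟩ * v)),
      (fun q : Quot R ↦ ((Nat.card
          {u : ℍ[ℚ,((-1 : ℤ) : ℚ),((3 : ℤ) : ℚ)] // (u ∈ order (-1) 3 ∨ u - ⟨1/2, 1/2, 1/2, -1/2⟩ ∈ order (-1) 3) ∧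
            ((u * star u).re = 1 ∨ (u * star u).re = -1) ∧
            u * ⟨0, q.out.1.1, q.out.1.2.1, q.out.1.2.2⟩ = ⟨0, q.out.1.1, q.out.1.2.1, q.out.1.2.2⟩ * u} : ℚ))⁻¹) (Φ ⟨c, b⟩) = ((if ((c : ℕ) : ℤ) ^ 2 = t then 4 else if ((c : ℕ) : ℤ) ^ 2 * 3 = t then 6 else 2))⁻¹ := by
    intro b
    induction b using Quot.ind with
    | _ x =>
      show ((Nat.card {u : ℍ[ℚ,((-1 : ℤ) : ℚ),((3 : ℤ) : ℚ)] // (u ∈ order (-1) 3 ∨ u - ⟨1/2, 1/2, 1/2, -1/2⟩ ∈ order (-1) 3) ∧ ((u * star u).re = 1 ∨ (u * star u).re = -1) ∧ u * (⟨0, ((Quot.mk R (sc c x)).out).1.1, ((Quot.mk R (sc c x)).out).1.2.1, ((Quot.mk R (sc c x)).out).1.2.2⟩ : ℍ[ℚ,((-1 : ℤ) : ℚ),((3 : ℤ) : ℚ)]) = (⟨0, ((Quot.mk R (sc c x)).out).1.1, ((Quot.mk R (sc c x)).out).1.2.1, ((Quot.mk R (sc c x)).out).1.2.2⟩ : ℍ[ℚ,((-1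 : ℤ) : ℚ),((3 : ℤ) : ℚ)]) * u} : ℚ))⁻¹ = _
      rw [hout, sc_vec, card_unitStab_content_smul_primitive ht (hcpos c) x.2.1 x.2.2]
  rw [Finset.sum_congr rfl fun b _ ↦ hconst b, Finset.sum_const, Finset.card_univ, ← Nat.card_eq_fintype_card,
    nsmul_eq_mul]
  exact (div_eq_mul_inv _ _).symm

/-- **SQUAREFREE `t`: `Σᶠ_{[x] ∈ L(t)/O₆^×} e_x⁻¹ = |L(t)/O₆^×| / w(t)`**, `w(1) = 4`, `w(3) = 6`, `w(t) = 2` otherwise —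
every vector of `L(t)` is primitive (`c² ∣ t ⟹ c = 1`) and `e` is the constant `w(t)`, so `deg Z(t)_ℚ =
2|L(t)/O₆^×|/w(t)`: the case `n ∈ {1, 2}` of (3.4.6), a single term `h(d)/w(d)`. [cite: KudlaRapoportYang2006, §3.4 (3.4.4)–(3.4.6) and (3.4.14)] [cite: VignerasLNM800, Ch. III §5.C Cor. 5.12] -/
theorem finsum_unit_classes_of_squarefree {t : ℤ} (ht : 0 < t) (hsq : Squarefree t) :
    ∑ᶠ q : (Quot (fun x y : {x : ℤ × ℤ × ℤ // x.1 ^ 2 - 3 * x.2.1 ^ 2 - 3 * x.2.2 ^ 2 = t} ↦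
      ∃ v : ℍ[ℚ,((-1 : ℤ) : ℚ),((3 : ℤ) : ℚ)], (v ∈ order (-1) 3 ∨ v - ⟨1/2, 1/2, 1/2, -1/2⟩ ∈ order (-1) 3) ∧
        ((v * star v).re = 1 ∨ (v * star v).re = -1) ∧
        v * ⟨0, x.1.1, x.1.2.1, x.1.2.2⟩ = ⟨0, y.1.1, y.1.2.1, y.1.2.2⟩ * v)),
        ((Nat.card
          {u : ℍ[ℚ,((-1 : ℤ) : ℚ),((3 : ℤ) : ℚ)] // (u ∈ order (-1) 3 ∨ u - ⟨1/2, 1/2, 1/2, -1/2⟩ ∈ order (-1) 3) ∧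
            ((u * star u).re = 1 ∨ (u * star u).re = -1) ∧
            u * ⟨0, q.out.1.1, q.out.1.2.1, q.out.1.2.2⟩ = ⟨0, q.out.1.1, q.out.1.2.1, q.out.1.2.2⟩ * u} : ℚ))⁻¹ =
    (Nat.card (Quot (fun x y : {x : ℤ × ℤ × ℤ // x.1 ^ 2 - 3 * x.2.1 ^ 2 - 3 * x.2.2 ^ 2 = t} ↦
      ∃ v : ℍ[ℚ,((-1 : ℤ) : ℚ),((3 : ℤ) : ℚ)], (v ∈ order (-1) 3 ∨ v - ⟨1/2, 1/2, 1/2, -1/2⟩ ∈ order (-1) 3) ∧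
        ((v * star v).re = 1 ∨ (v * star v).re = -1) ∧
        v * ⟨0, x.1.1, x.1.2.1, x.1.2.2⟩ = ⟨0, y.1.1, y.1.2.1, y.1.2.2⟩ * v)) : ℚ) / (if t = 1 then 4 else if t = 3 then 6 else 2) := by
  haveI := finite_unit_classes ht
  have he : ∀ x : {x : ℤ × ℤ × ℤ // x.1 ^ 2 - 3 * x.2.1 ^ 2 - 3 * x.2.2 ^ 2 = t}, (Nat.card {u : ℍ[ℚ,((-1 : ℤ) : ℚ),((3 : ℤ) : ℚ)] // (u ∈ order (-1) 3 ∨ u - ⟨1/2, 1/2, 1/2, -1/2⟩ ∈ order (-1) 3) ∧ ((u * star u).re = 1 ∨ (u * star u).re = -1) ∧ u * (⟨0, x.1.1, x.1.2.1, x.1.2.2⟩ : ℍ[ℚ,((-1 : ℤ) : ℚ),((3 : ℤ) : ℚ)]) = (⟨0, x.1.1, x.1.2.1, x.1.2.2⟩ : ℍ[ℚ,((-1 : ℤ) : ℚ),((3 : ℤ) : ℚ)]) * u} : ℚ) = (if t = 1 then 4 else if t = 3 then 6 else 2) := by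
    intro x
    obtain ⟨c, p, hc, hp, hX, hct⟩ := exists_content_of_mem t ht.ne' x
    have hc1 : c = 1 := by
      by_contra h
      exact ne_of_squarefree₃₉ hsq h _ hct
    subst hc1
    generalize hq : (p 0 ^ 2 - 3 * p 1 ^ 2 - 3 * p 2 ^ 2) = q at hct
    have hqt : q = t := by simpa using hct
    by_cases h1 : t = 1
    · rw [if_pos h1]
      exact_mod_cast card_unitStab_eq_four (c := ((1 : ℕ) : ℚ)) (by norm_num) hp hX (by rw [hq, hqt, h1])
    · by_cases h3 : t = 3
      · rw [if_neg h1, if_pos h3]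
        exact_mod_cast card_unitStab_eq_six (c := ((1 : ℕ) : ℚ)) (by norm_num) hp hX (by rw [hq, hqt, h3])
      · rw [if_neg h1, if_neg h3]
        exact_mod_cast card_unitStab_eq_two (c := ((1 : ℕ) : ℚ)) (by norm_num) hp hX (by rw [hq]; omega)
          (by rw [hq, hqt]; exact h3)
  rw [finsum_eq_card_mul_of_forall_eq₃₉
    (f := fun q : (Quot (fun x y : {x : ℤ × ℤ × ℤ // x.1 ^ 2 - 3 * x.2.1 ^ 2 - 3 * x.2.2 ^ 2 = t} ↦
      ∃ v : ℍ[ℚ,((-1 : ℤ) : ℚ),((3 : ℤ) : ℚ)], (v ∈ order (-1) 3 ∨ v - ⟨1/2, 1/2, 1/2, -1/2⟩ ∈ order (-1) 3) ∧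
        ((v * star v).re = 1 ∨ (v * star v).re = -1) ∧
        v * ⟨0, x.1.1, x.1.2.1, x.1.2.2⟩ = ⟨0, y.1.1, y.1.2.1, y.1.2.2⟩ * v)) ↦ ((Nat.card
          {u : ℍ[ℚ,((-1 : ℤ) : ℚ),((3 : ℤ) : ℚ)] // (u ∈ order (-1) 3 ∨ u - ⟨1/2, 1/2, 1/2, -1/2⟩ ∈ order (-1) 3) ∧
            ((u * star u).re = 1 ∨ (u * star u).re = -1) ∧
            u * ⟨0, q.out.1.1, q.out.1.2.1, q.out.1.2.2⟩ = ⟨0, q.out.1.1, q.out.1.2.1, q.out.1.2.2⟩ * u} : ℚ))⁻¹)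
    (a := (if t = 1 then (4 : ℚ) else if t = 3 then 6 else 2)⁻¹) (fun q ↦ by
      obtain ⟨x⟩ := q
      rw [card_unitStab_mk_out, he x])]
  exact (div_eq_mul_inv _ _).symm

/-- **`Σᶠ_{[x] ∈ L(1)/Γ₆} e_x⁻¹ = 1`** — four `Γ₆`-classes (`±i`, `±E`) each with `e = 4 = |ℤ[i]^×|`, over the two elliptic
points of order `2` of `X₆`: `deg Z(1)_ℚ = 1`. [cite: KudlaRapoportYang2006, §3.4 (3.4.14)] [cite: BayerTravesa2007, §1 Thm. 1.1] -/
theorem finsum_normOne_classes_one :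
    ∑ᶠ q : (Quot (fun x y : {x : ℤ × ℤ × ℤ // x.1 ^ 2 - 3 * x.2.1 ^ 2 - 3 * x.2.2 ^ 2 = 1} ↦
      ∃ u : ℍ[ℚ,((-1 : ℤ) : ℚ),((3 : ℤ) : ℚ)], (u ∈ order (-1) 3 ∨ u - ⟨1/2, 1/2, 1/2, -1/2⟩ ∈ order (-1) 3) ∧
        (u * star u).re = 1 ∧ u * ⟨0, x.1.1, x.1.2.1, x.1.2.2⟩ = ⟨0, y.1.1, y.1.2.1, y.1.2.2⟩ * u)),
        ((Nat.card
          {u : ℍ[ℚ,((-1 : ℤ) : ℚ),((3 : ℤ) : ℚ)] // (u ∈ order (-1) 3 ∨ u - ⟨1/2, 1/2, 1/2, -1/2⟩ ∈ order (-1) 3) ∧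
            ((u * star u).re = 1 ∨ (u * star u).re = -1) ∧
            u * ⟨0, q.out.1.1, q.out.1.2.1, q.out.1.2.2⟩ = ⟨0, q.out.1.1, q.out.1.2.1, q.out.1.2.2⟩ * u} : ℚ))⁻¹ = 1 := by
  rw [finsum_normOne_classes_eq_two_mul_finsum_unit_classes one_pos,
    finsum_unit_classes_of_squarefree one_pos squarefree_one, card_unit_classes_one]
  norm_num

/-- **`Σᶠ_{[x] ∈ L(3)/Γ₆} e_x⁻¹ = 2/3`** — four `Γ₆`-classes each with `e = 6 = |ℤ[ζ₃]^×|`, over the two elliptic points of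
order `3` of `X₆`: `deg Z(3)_ℚ = 2/3`. [cite: KudlaRapoportYang2006, §3.4 (3.4.14)] [cite: BayerTravesa2007, §1 Thm. 1.1] -/
theorem finsum_normOne_classes_three :
    ∑ᶠ q : (Quot (fun x y : {x : ℤ × ℤ × ℤ // x.1 ^ 2 - 3 * x.2.1 ^ 2 - 3 * x.2.2 ^ 2 = 3} ↦
      ∃ u : ℍ[ℚ,((-1 : ℤ) : ℚ),((3 : ℤ) : ℚ)], (u ∈ order (-1) 3 ∨ u - ⟨1/2, 1/2, 1/2, -1/2⟩ ∈ order (-1) 3) ∧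
        (u * star u).re = 1 ∧ u * ⟨0, x.1.1, x.1.2.1, x.1.2.2⟩ = ⟨0, y.1.1, y.1.2.1, y.1.2.2⟩ * u)),
        ((Nat.card
          {u : ℍ[ℚ,((-1 : ℤ) : ℚ),((3 : ℤ) : ℚ)] // (u ∈ order (-1) 3 ∨ u - ⟨1/2, 1/2, 1/2, -1/2⟩ ∈ order (-1) 3) ∧
            ((u * star u).re = 1 ∨ (u * star u).re = -1) ∧
            u * ⟨0, q.out.1.1, q.out.1.2.1, q.out.1.2.2⟩ = ⟨0, q.out.1.1, q.out.1.2.1, q.out.1.2.2⟩ * u} : ℚ))⁻¹ = 2 / 3 := by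
  rw [finsum_normOne_classes_eq_two_mul_finsum_unit_classes (by norm_num),
    finsum_unit_classes_of_squarefree (by norm_num) Int.prime_three.squarefree, card_unit_classes_three]
  norm_num

end Content

end Literature.Geometry.Kaehler.ComplexTorus.QuaternionType
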